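import Literature.Barriers.CriticalPhenomena.LongRangeTrivialityOnZ3BubbleAudit
import HarnessLib

/-!
# Audit (D-0021, generation 4) of `LongRangeTrivialityOnZ3Proofs.lean`: the EXACT reach of the
# tree-diagram mechanism on `ℤ³` is `χ_L(β_c) = o(L^{3/2})` — proved in both directions; the
# nearest-neighbour model clears even this bar (Duminil-Copin–Panis 2025, Theorem 1.3), the divergence
# of its bubble diagram alone does not

Barrier catalogue `Literature/Barriers/CriticalPhenomena/` (D-0021), sub-problem `Ising3DConformalLimit`.
Fourth audit record (refuter, barrier-audit mode, generation 4, 2026-08-15) for the sibling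
`LongRangeTrivialityOnZ3Proofs.lean` (discharge of `panis_variance_bound`) of the barrier
`LongRangeTrivialityOnZ3`, after `LongRangeTrivialityOnZ3ProofsAudit.lean` (generation 1: the discharge
CONFIRMED; the technique class is the extensional `InteractionUniformZ3`; the lower half of the variance
footnote is literally false), `LongRangeTrivialityOnZ3BubbleAudit.lean` (generation 2: the dividing line is
the bubble condition — `BubbleTrivialityOnZ3`, PROVED) and `LongRangeTrivialityOnZ3PointwiseAudit.lean`
(generation 3: the pointwise clause (iii) is blocked as well). Generation 2 left scope caveat (e): "nothing is
said about … the size of the gap between `√(log n)` bubble growth and non-Gaussianity", and credited the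
nearest-neighbour model with an evasion — `B(β_c) = ∞` (Duminil-Copin–Panis 2025, Theorem 1.8). This audit
attacks the technique class once more — is "bubble-blind" really the whole class the printed mechanism
blocks, and is the divergence of the bubble really what lets the nearest-neighbour model out? — and answers
both with theorems: NO and NO. The mechanism (tree-graph Wick bound, Gaussianity read off through
`𝒮_T → 0`) reaches exactly the interactions with `χ_L(β_c) = ∑_{x∈Λ_L}⟨σ₀σ_x⟩_{β_c} = o(L^{3/2})`
(sufficiency and necessity proved below, MMS2 granted), a class that contains the bubble-blind one —
strictly, at the level of the two-point hypotheses — and is NOT left through a `√(log n)` divergence of the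
bubble; the nearest-neighbour model leaves it
nonetheless, by the reflected-current LOWER bound of the same paper (Theorem 1.3), which forces
`limsup χ_n(β_c)/n^{3/2} > 0` on `ℤ³`.

## Verdict: NARROWED (the technique class, sharpened to its provably maximal form for this mechanism:
## `SusceptibilityTrivialityOnZ3`, PROVED, implies `BubbleTrivialityOnZ3` and `LongRangeTrivialityOnZ3`);
## the recorded nearest-neighbour evasion RE-ATTRIBUTED (Theorem 1.3, not Theorem 1.8, of
## Duminil-Copin–Panis 2025); the audited discharge `panis_variance_bound_holds` CONFIRMED again (it is
## an input of `tendsto_mgfDeviation_of_boxSusceptibility`)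

### A. What the sources print (page level, re-read for this audit)

* Panis, Remark 1.6 (arXiv p. 7): "the bubble condition `B(β_c) < ∞` implies that some of the model's
  critical exponents take their mean-field value. It is also possible to show that the bubble condition
  (together with some monotonicity properties of the two-point function), implies triviality of the scaling
  limits"; Theorem 12.2 (p. 51) and its proof (the tree diagram bound `0 ≤ g_σ ≤ 2χ²/ξ_σ^d`, the splitting
  of `χ`, Cauchy–Schwarz, the MMS bound); proof of Theorem 5.5 (pp. 21–22): `S(β,L,f)`, the tree diagram
  bound, the bounds on (1) and (2). [cite: Panis2023Triviality, Remark 1.6 (p. 7), proof of Theorem 5.5 (pp. 21–22), Theorem 12.2 (p. 51)]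
* Aizenman, CDM 2020, §10.1 (p. 31): "for quadruples of points at mutual distances of order `L` …
  `|U₄|/S₄ ≤ CL^d/L^{2(d-2+η)} = C/L^{d-4+2η}`" — on `ℤ³` the exponent is `2η - 1`: the dimension count
  decides at `η = 1/2`, i.e. at `χ_L ≍ L^{2-η} = L^{3/2}`. [cite: AizenmanCDM2020, §10.1 eqs. (10.1)–(10.2), p. 31]
* Duminil-Copin–Panis, CMP 406 (2025) = arXiv:2404.05700, read pp. 3–7 of the held text: the MMS footnote of
  §1 ("(i) the sequence `(⟨τ₀τ_{ke₁}⟩_β)_{k≥0}` is decreasing; (ii) for any `x ∈ ℤ^d`,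
  `⟨τ₀τ_{(|x|₁,0_⊥)}⟩_β ≤ ⟨τ₀τ_x⟩_β ≤ ⟨τ₀τ_{(|x|,0_⊥)}⟩_β`"); "Theorem 1.3. Let `d ≥ 3`. There exist
  `c₁, N₁ > 0` such that for all `β ≤ β_c` and for all `N₁ ≤ n ≤ L(β)`,
  `⟨τ₀τ_{ne₁}⟩_β ≥ c₁/(χ_{4n}(β) + n^{d-2}∑_{1≤k≤2n}k⟨τ₀τ_{ke₁}⟩_β)`" (`χ_n(β) = ∑_{x∈Λ_n}⟨τ₀τ_x⟩_β`,
  `Λ_n = [-n,n]^d ∩ ℤ^d`, `L(β)` the sharp length of Definition 1.1, `L(β_c) = ∞`); "Theorem 1.4 (Pointwise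
  lower bound in dimension `d ≥ 4`) … `c/|x|^{d-2}` if `d ≥ 5`, `c/(|x|²log|x|)` if `d = 4`"; "When `d = 3`
  we do not obtain a more explicit pointwise lower bound, but we still improve on the existing bound on `η`.
  Theorem 1.5. Let `d = 3`. If the critical exponent `η` exists, it satisfies `η ≤ 1/2`"; "Theorem 1.8
  (Divergence of the bubble diagram). Let `d = 3, 4`. Then `B(β_c) = ∞`", proved at `β_c` from Theorem 1.2
  by contradiction ("If `d = 3`, … `⟨τ₀τ_{(n/4)e₁}⟩_{β_c} ≥ c₃/n^{3/2}`. This contradicts, once again, the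
  finiteness of the bubble diagram"); "Remark 1.9 … `B_n(β) ≥ c√(log n)` if `d = 3`".
  [cite: DuminilCopinPanis2025LowerBounds, §1 (MMS footnote), Theorems 1.3, 1.4, 1.5, 1.8 and Remark 1.9]

### B. What is proved here (all theorems; ONE definition, the sharpened barrier `SusceptibilityTrivialityOnZ3`, D-0026)

For `d = 3`, a ferromagnetic translation-invariant pair interaction `J ≥ 0`, `β ≥ 0`, MMS2 at `β`
(`⟨σ₀σ_y⟩ ≤ ⟨σ₀σ_x⟩` for `3‖x‖_∞ ≤ ‖y‖_∞`), namespace `LongRangeIsing`: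

* `pairCorrelation_sq_mul_cube_le_of_boxSusceptibility`: `χ_k² ≤ εk³` (`k ≥ L₁`) and MMS2 give the
  pointwise decay `⟨σ₀σ_w⟩²|w|_∞³ ≤ ε` for `|w|_∞ ≥ 3(L₁+1)`;
* `boxRowSum_pow_four_le_far_of_decay`: far from the box, `F_{RL}(u)⁴ ≤ 9|Λ_{RL}|⁴δ²|u|_∞^{-6}`;
* `treeFourBoxSum_le_of_boxSusceptibility` (with `susceptibility_bookkeeping`, `exists_nat_le_mul_pow_six`):
  the TWO-REGIME majorant — `a⁴ = (730·125R³χ_L)⁴` up to the crossover radius `M₁` (least `m` with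
  `9|Λ_{RL}|⁴δ² ≤ a⁴m⁶`), `9|Λ_{RL}|⁴δ²|v|^{-6}` beyond (a single-power interpolation `min(a,b|v|^{-3/2})⁴ ≤
  a²b²|v|^{-3}` is not summable in `ℤ³`; the crossover is essential) — has mass
  `≤ (8RL+1)³a⁴ + (27 + 26/3)a⁴M₁³` with `a⁴M₁³ ≤ 24a²|Λ_{RL}|²δ + a⁴`, whence the tree diagrams on `Λ_{RL}`
  are finite and `𝒮_T(β,L,R) ≤ 10⁵(730·125)⁴R¹⁵(ε + δ)` once `χ_L² ≤ εL³`;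
* `tendsto_treeFourBoxSum_of_boxSusceptibility` (`χ_L²/L³ → 0 ⟹ 𝒮_T → 0`),
  `tendsto_mgfDeviation_of_boxSusceptibility` (`β > 0`; through the PROVED tree-graph Wick bound
  `mgfDeviation_le_tree` and the audited variance bound `state_smeared_sq_le`);
* `tendsto_boxSusceptibility_sq_div_of_summable_sq`: the bubble condition implies the hypothesis
  (generation 2's `ℓ`-split at `u = 0`) — so generation 4 CONTAINS generation 2;
* `boxSusceptibility_sq_div_le_treeFourBoxSum`: CONVERSELY, with finite tree diagrams
  `χ_L²/L³ ≤ 3⁹R⁹𝒮_T(β,L,R)` (Jensen twice, `∑_vF_{RL}(v) = Σ_{RL} ≥ Σ_L ≥ (L+1)³χ_L`) — so `𝒮_T → 0`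
  if and ONLY if `χ_L²/L³ → 0`: the hypothesis is the exact reach of the mechanism;
* outside the namespace: `not_hasNonGaussianSmearingZ3_of_boxSusceptibility` (at `β_c`; `β_c = 0` by
  independence), the sharpened barrier `SusceptibilityTrivialityOnZ3` (structured block below),
  `SusceptibilityTrivialityOnZ3_holds`, `.bubbleTrivialityOnZ3` (⟹ generation 2's barrier),
  `.longRangeTrivialityOnZ3` (⟹ the catalogued one), `.of_member`,
  `hasNonGaussianSmearingZ3_member_imp_not_tendsto` / `…_imp_frequently` (NECESSITY: a non-Gaussian
  critical smearing of any MMS-monotone member of `Z3Model` — the nearest-neighbour one included, granted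
  MMS2 for it — forces `χ_L(β_c)² ≥ cL³` for some `c > 0` and infinitely many `L`) and
  `interactionUniformZ3_susceptibility_triviality`.

### C. The gap, quantified (generation 2's caveat (e)), and the re-attribution of the evasion

* The sharpened class is STRICTLY larger than the bubble-blind one, and the enlargement is exactly the
  `√(log n)` window: a two-point function `⟨σ₀σ_x⟩ ≍ |x|^{-3/2}(log|x|)^{-1/4}` has
  `B_n = ∑_{|x|≤n}⟨σ₀σ_x⟩² ≍ √(log n) → ∞` — precisely the nearest-neighbour growth established in Remark 1.9
  — and `χ_L ≍ L^{3/2}(log L)^{-1/4} = o(L^{3/2})`, hence (MMS2 granted) Gaussian critical smearings by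
  `SusceptibilityTrivialityOnZ3_holds`. So NEITHER `B(β_c) = ∞` NOR `B_n(β_c) ≥ c√(log n)` takes a model out
  of the reach of the tree-diagram mechanism; the evasion recorded by generations 1–2 under these headings is,
  as stated, insufficient.
* What does take the nearest-neighbour model out is Theorem 1.3 (at `β_c`, where `L(β_c) = ∞`, exactly as
  in the printed proof of Theorem 1.8). Paper derivation (this audit; `d = 3`, `S_k := ⟨σ₀σ_{ke₁}⟩_{β_c}`):
  suppose `χ_n(β_c) ≤ εn^{3/2}` for all `n ≥ n₀`. By the MMS footnote, `⟨σ₀σ_x⟩ ≥ S_{|x|₁}` and the `ℓ¹`-sphere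
  of radius `k` in `ℤ³` has `4k² + 2` points, so `∑_{k≤m}k²S_k ≤ χ_m/4`; summing dyadically,
  `∑_{n₀<k≤2n}kS_k ≤ ∑_j 2^{-j}χ_{2^{j+1}}/4 ≤ Cε√n`, hence `χ_{4n} + n∑_{k≤2n}kS_k ≤ 8εn^{3/2} + nA_{n₀} + Cεn^{3/2}
  ≤ C′εn^{3/2}` for `n ≥ (A_{n₀}/ε)²`, and Theorem 1.3 gives `S_n ≥ c₁/(C′εn^{3/2})`; then
  `⟨σ₀σ_x⟩_{β_c} ≥ c₁/(C′ε|x|₁^{3/2})` and `χ_n(β_c) ≥ ∑_{k≤n}(4k²+2)c₁/(C′εk^{3/2}) ≥ (c₂/ε)n^{3/2}` for large `n`,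
  contradicting `χ_n ≤ εn^{3/2}` as soon as `ε² < c₂`. Hence, UNCONDITIONALLY for the nearest-neighbour model
  on `ℤ³`: `limsup_n χ_n(β_c)/n^{3/2} ≥ √c₂ > 0` — the lim-sup form of "`η ≤ 1/2`" (Theorem 1.5 is the
  version under the existence of `η`), and EXACTLY the necessary condition
  `hasNonGaussianSmearingZ3_member_imp_frequently` isolates. The two formalisations of the nearest-neighbour
  state (`NNIsing.…` and `LongRangeIsing.state (nnCoupling 3)`) are not bridged, so this half stays on paper.
* It is still not sufficient: on `ℤ⁴` Theorem 1.4 gives `⟨τ₀τ_x⟩ ≥ c/(|x|²log|x|)`, so `χ_L ≳ L²/log L ≫ L^{3/2}`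
  — far outside the analogous class — and the critical scaling limits are Gaussian (Aizenman–Duminil-Copin);
  on `ℤ³` the marginal member `α = 3/2` (`⟨σ₀σ_x⟩ ≍ |x|^{-3/2}` up to constants, `χ_L ≍ L^{3/2}`) is Gaussian by
  Panis's improved tree diagram bound (Theorem 1.9, Corollary 1.11) — a different mechanism, which this
  barrier neither uses nor blocks. The live gap is therefore no longer on the two-point side (where the
  nearest-neighbour input exists and is of the right strength) but a LOWER bound on `|U₄|` comparable to the
  tree diagram: a uniformly positive probability that two critical current clusters with sources at mutual
  distance `L` intersect (Aizenman's Lemma 8.1, eq. (8.1); open question 1 of §11; in `d = 2` this is the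
  planarity bound (6.7)). [cite: AizenmanCDM2020, Lemma 8.1 eq. (8.1) (p. 25), §6.3 eq. (6.7) (p. 22) and §11 (p. 35)]

### D. Consequences for the parent blocks (text; recorded here in case the docstring edits are not applied)

`LongRangeTrivialityOnZ3`, technique_class / evasions_known, and `BubbleTrivialityOnZ3`, scope_caveats (e)
and evasions_known: append "AUDIT 2026-08-15, generation 4 (`LongRangeTrivialityOnZ3SusceptibilityAudit.lean`):
the bubble-blind class is contained in the sharper TREE-DIAGRAM-BLIND class of `SusceptibilityTrivialityOnZ3`
— MMS2 at `β_c` and `χ_L(β_c)²/L³ → 0` (PROVED sufficient: `SusceptibilityTrivialityOnZ3_holds`; and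
necessary for the mechanism: `boxSusceptibility_sq_div_le_treeFourBoxSum`); `B(β_c) = ∞` with
`B_n ≥ c√(log n)` does NOT leave it (`⟨σ₀σ_x⟩ ≍ |x|^{-3/2}(log|x|)^{-1/4}`); the nearest-neighbour model on `ℤ³`
leaves it by Theorem 1.3 of Duminil-Copin–Panis 2025 (`limsup χ_n(β_c)/n^{3/2} > 0`, paper derivation in
that file), which is exactly the necessary condition `hasNonGaussianSmearingZ3_member_imp_frequently`; the
missing piece is unchanged: a lower bound on `|U₄|` of the order of the tree diagram."

### E. Literature (evasion search, this generation)

Held texts re-read: Duminil-Copin–Panis 2025 (pp. 3–7), Panis 2023 (as read by generations 1–3), Aizenman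
CDM 2020 (§§8, 10, 11 as read by generation 3). No published argument derives non-Gaussianity of a critical
ferromagnet on `ℤ³` from two-point input alone, and none could within this mechanism (Section B); no published
lower bound on `|U₄|` at criticality in `d = 3` is known to the catalogue (the `d = 2` one uses planarity).

## References

* R. Panis, arXiv:2309.05797 (2023) = Ann. Probab. 54 (2026): Remark 1.6 (p. 7), Corollary 1.11 (p. 8),
  Theorem 1.9, Corollary 3.3, proof of Theorem 5.5 (pp. 21–22), Theorem 12.2 (p. 51) [Panis2023Triviality].
* H. Duminil-Copin, R. Panis, Commun. Math. Phys. 406 (2025), arXiv:2404.05700: §1 (MMS footnote),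
  Theorems 1.3, 1.4, 1.5, 1.8, Remark 1.9 [DuminilCopinPanis2025LowerBounds] (held; read pp. 3–7).
* M. Aizenman, CDM 2020, arXiv:2112.04248: Lemma 8.1 (p. 25), §6.3 (6.7) (p. 22), §10.1 (10.1)–(10.2)
  (p. 31), §11 (p. 35) [AizenmanCDM2020].
* M. Aizenman, H. Duminil-Copin, Ann. Math. 194 (2021), Theorem 1.2 [AizenmanDuminilCopinAnnals2021].

## Tree anchors

`boxRowSum_le_uniform_mms`, `sq_boxRowSum_le_split`, `bubbleTail(_nonneg)`, `summable_bubbleTail`,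
`tendsto_tsum_bubbleTail`, `BubbleTrivialityOnZ3(.longRangeTrivialityOnZ3)`, `Z3Model.coupling_nonneg/add`
(`…BubbleAudit`); `treeFourE`, `treeFourBoxSum(_nonneg)`, `treeFourE_finite_and_sum_toReal_le`,
`mgfDeviation_le_tree` (`…TreeWick`); `boxRowSum(_nonneg)`, `rowMajorant(_nonneg)`, `summable_rowMajorant`,
`sum_piFinset_prod_eq` (`…UrsellSum`); `card_box_mul_pairCorrelation_le_boxSusceptibility`
(`…NoSlidingScale`); `pairCorrelation_nonneg/eq/zero_sub`, `boxSusceptibility_nonneg`, `one_le_boxSusceptibility`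
(`…TwoPoint`); `pow_mul_boxSusceptibility_le_blockVariance` (`…TwoPointProofs`); `state_smeared_sq_le`,
`blockVariance_eq_sum`, `one_le_blockVariance`, `state_spinProduct_nonneg`, `criticalBeta_nonneg` (`…Proofs`);
`exists_nat_forall_abs_apply_le` (`…Inputs`); `not_hasNonGaussianSmearingZ3_of_criticalBeta_eq_zero`
(`…Reduction`); Mathlib: `sq_sum_le_card_mul_sum_sq`, `Nat.find(_spec/_min)`, `lt_of_pow_lt_pow_left₀`,
`inv_anti₀`, `Summable.sum_le_tsum`, `ENNReal.sum_le_tsum`, `ENNReal.ofReal_sum_of_nonneg`,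
`ENNReal.ofReal_le_iff_le_toReal`, `ENNReal.toReal_sum`, `Filter.Tendsto.const_div_atTop`, `tendsto_order`,
`Filter.not_frequently`, `squeeze_zero'`.
-/

noncomputable section

namespace Literature.Barriers.CriticalPhenomena

open Literature.Probability.LatticeModels Literature.Probability.Percolation Filter Topology Finset
open scoped ENNReal

namespace LongRangeIsing

section Susceptibility

variable (J : Site 3 → Site 3 → ℝ) (β : ℝ)

/-! #### Step 1: decay of the two-point function from MMS2 and `χ_k² ≤ ε k³` -/

/-- **Pointwise decay from MMS2 and a bound on the box susceptibility**: if `χ_k(β)² ≤ ε k³` for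
`k ≥ L₁` and the two-point function is MMS-monotone, then `⟨σ₀σ_w⟩² |w|_∞³ ≤ ε` for `|w|_∞ ≥ 3(L₁+1)`
(average MMS2 over `Λ_k`, `k = ⌊|w|_∞/3⌋`: `(2k+1)³⟨σ₀σ_w⟩ ≤ χ_k`, and `|w|_∞ k ≤ (2k+1)²`).
[cite: Panis2023Triviality, Corollary 3.3 (MMS2)] -/
theorem pairCorrelation_sq_mul_cube_le_of_boxSusceptibility (hβ : 0 ≤ β) (hJ : ∀ x y, 0 ≤ J x y)
    (hmms : ∀ x y : Site 3, (3 : ℝ) * ‖x‖ ≤ ‖y‖ → pairCorrelation J β 0 y ≤ pairCorrelation J β 0 x)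
    {ε : ℝ} {L₁ : ℕ} (hχ : ∀ k : ℕ, L₁ ≤ k → boxSusceptibility J β k ^ 2 ≤ ε * (k : ℝ) ^ 3)
    {w : Site 3} (hw : 3 * (L₁ + 1) ≤ Site.supNorm w) :
    pairCorrelation J β 0 w ^ 2 * (Site.supNorm w : ℝ) ^ 3 ≤ ε := by
  set n : ℕ := Site.supNorm w with hn
  set k : ℕ := n / 3 with hk
  have hk1 : L₁ + 1 ≤ k := by
    rw [hk]
    exact (Nat.le_div_iff_mul_le (by norm_num)).2 (by omega)
  have h3k : 3 * k ≤ n := by rw [hk]; omega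
  have hn3k : n ≤ 3 * k + 2 := by rw [hk]; omega
  have hkpos : 1 ≤ k := by omega
  have hmms' : ∀ x y : Site 3, ((3 : ℕ) : ℝ) * ‖x‖ ≤ ‖y‖ →
      pairCorrelation J β 0 y ≤ pairCorrelation J β 0 x := fun x y h => hmms x y (by exact_mod_cast h)
  have hS0 : 0 ≤ pairCorrelation J β 0 w := pairCorrelation_nonneg J β hβ hJ 0 w
  have h1 : (#(box 3 k) : ℝ) * pairCorrelation J β 0 w ≤ boxSusceptibility J β k :=
    card_box_mul_pairCorrelation_le_boxSusceptibility J β hmms' (L := k) (y := w) h3k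
  have hcard : (#(box 3 k) : ℝ) = (2 * (k : ℝ) + 1) ^ 3 := by rw [card_box]; push_cast; ring
  rw [hcard] at h1
  have h2 : ((2 * (k : ℝ) + 1) ^ 3 * pairCorrelation J β 0 w) ^ 2 ≤ ε * (k : ℝ) ^ 3 :=
    (pow_le_pow_left₀ (mul_nonneg (by positivity) hS0) h1 2).trans (hχ k (by omega))
  have hk0 : (0 : ℝ) < k := by exact_mod_cast hkpos
  have hnk : (n : ℝ) * k ≤ (2 * (k : ℝ) + 1) ^ 2 := by
    have : (n : ℝ) ≤ 3 * k + 2 := by exact_mod_cast hn3k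
    nlinarith [this, hk0.le]
  have hnk3 : ((n : ℝ) * k) ^ 3 ≤ ((2 * (k : ℝ) + 1) ^ 2) ^ 3 := pow_le_pow_left₀ (by positivity) hnk 3
  have key : pairCorrelation J β 0 w ^ 2 * (n : ℝ) ^ 3 * (k : ℝ) ^ 3 ≤ ε * (k : ℝ) ^ 3 := by
    calc pairCorrelation J β 0 w ^ 2 * (n : ℝ) ^ 3 * (k : ℝ) ^ 3
        = pairCorrelation J β 0 w ^ 2 * ((n : ℝ) * k) ^ 3 := by ring
      _ ≤ pairCorrelation J β 0 w ^ 2 * ((2 * (k : ℝ) + 1) ^ 2) ^ 3 :=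
          mul_le_mul_of_nonneg_left hnk3 (sq_nonneg _)
      _ = ((2 * (k : ℝ) + 1) ^ 3 * pairCorrelation J β 0 w) ^ 2 := by ring
      _ ≤ ε * (k : ℝ) ^ 3 := h2
  exact le_of_mul_le_mul_right key (by positivity)

/-! #### Step 2: the row sums far from the box, from the decay -/

/-- **Far row sums from the decay `⟨σ₀σ_w⟩²|w|_∞³ ≤ δ`** (`|w|_∞ ≥ W₀`): for `|u|_∞ ≥ 4RL+1`, `L ≥ W₀`,
`R ≥ 1`, every `y ∈ Λ_{RL}` has `|y-u|_∞ ≥ ¾|u|_∞`, so `⟨σ_uσ_y⟩² ≤ 3δ/|u|_∞³` and (Cauchy–Schwarz)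
`F_{RL}(u)⁴ ≤ 9|Λ_{RL}|⁴δ²/|u|_∞⁶`. [folklore] -/
theorem boxRowSum_pow_four_le_far_of_decay (hβ : 0 ≤ β) (hJ : ∀ x y, 0 ≤ J x y)
    (hJt : ∀ a x y, J (x + a) (y + a) = J x y)
    {δ : ℝ} (hδ : 0 ≤ δ) {W₀ : ℕ}
    (hdec : ∀ w : Site 3, W₀ ≤ Site.supNorm w →
      pairCorrelation J β 0 w ^ 2 * (Site.supNorm w : ℝ) ^ 3 ≤ δ)
    {R L : ℕ} (hR : 1 ≤ R) (hW : W₀ ≤ L) {u : Site 3} (hu : 4 * (R * L) + 1 ≤ Site.supNorm u) :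
    boxRowSum J β (R * L) u ^ 4 ≤
      9 * (#(box 3 (R * L)) : ℝ) ^ 4 * δ ^ 2 / (Site.supNorm u : ℝ) ^ 6 := by
  set N : ℕ := R * L with hN
  set n : ℕ := Site.supNorm u with hn
  set V : ℝ := (#(box 3 N) : ℝ) with hV
  have hLN : L ≤ N := by rw [hN]; exact Nat.le_mul_of_pos_left L hR
  have hnpos : 0 < n := by omega
  have hn0 : (0 : ℝ) < n := by exact_mod_cast hnpos
  have hpt : ∀ y ∈ box 3 N, pairCorrelation J β u y ^ 2 ≤ 3 * δ / (n : ℝ) ^ 3 := by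
    intro y hy
    have hyN : Site.supNorm y ≤ N := mem_box_iff_supNorm_le.1 hy
    have htri : Site.supNorm u ≤ Site.supNorm (y - u) + Site.supNorm y := by
      have h := Site.supNorm_le_supNorm_sub_add u y
      rwa [← Site.supNorm_neg (u - y), neg_sub] at h
    have hwW : W₀ ≤ Site.supNorm (y - u) := by omega
    have h34 : 3 * n ≤ 4 * Site.supNorm (y - u) := by omega
    have hdw := hdec (y - u) hwW
    rw [pairCorrelation_zero_sub J β hβ hJ hJt u y] at hdw
    have hsw : (27 : ℝ) * (n : ℝ) ^ 3 ≤ 64 * (Site.supNorm (y - u) : ℝ) ^ 3 := by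
      have h : (3 : ℝ) * n ≤ 4 * (Site.supNorm (y - u) : ℝ) := by exact_mod_cast h34
      calc (27 : ℝ) * (n : ℝ) ^ 3 = (3 * (n : ℝ)) ^ 3 := by ring
        _ ≤ (4 * (Site.supNorm (y - u) : ℝ)) ^ 3 := pow_le_pow_left₀ (by positivity) h 3
        _ = 64 * (Site.supNorm (y - u) : ℝ) ^ 3 := by ring
    have hSy0 : 0 ≤ pairCorrelation J β u y ^ 2 := sq_nonneg _
    rw [le_div_iff₀ (by positivity : (0 : ℝ) < (n : ℝ) ^ 3)]
    have e1 : pairCorrelation J β u y ^ 2 * (27 * (n : ℝ) ^ 3) ≤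
        pairCorrelation J β u y ^ 2 * (64 * (Site.supNorm (y - u) : ℝ) ^ 3) :=
      mul_le_mul_of_nonneg_left hsw hSy0
    nlinarith [e1, hdw, hδ]
  have hF0 : 0 ≤ boxRowSum J β N u := boxRowSum_nonneg J β hβ hJ N u
  have hF2 : boxRowSum J β N u ^ 2 ≤ 3 * V ^ 2 * δ / (n : ℝ) ^ 3 := by
    calc boxRowSum J β N u ^ 2 = (∑ y ∈ box 3 N, pairCorrelation J β u y) ^ 2 := by rw [boxRowSum]
      _ ≤ #(box 3 N) * ∑ y ∈ box 3 N, pairCorrelation J β u y ^ 2 := sq_sum_le_card_mul_sum_sq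
      _ ≤ #(box 3 N) * ∑ _y ∈ box 3 N, 3 * δ / (n : ℝ) ^ 3 := by
          gcongr with y hy
          exact hpt y hy
      _ = V * (V * (3 * δ / (n : ℝ) ^ 3)) := by rw [Finset.sum_const, nsmul_eq_mul, hV]
      _ = 3 * V ^ 2 * δ / (n : ℝ) ^ 3 := by ring
  calc boxRowSum J β N u ^ 4 = (boxRowSum J β N u ^ 2) ^ 2 := by ring
    _ ≤ (3 * V ^ 2 * δ / (n : ℝ) ^ 3) ^ 2 := pow_le_pow_left₀ (sq_nonneg _) hF2 2
    _ = 9 * V ^ 4 * δ ^ 2 / (n : ℝ) ^ 6 := by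
        field_simp
        ring

/-! #### Step 3: the two-regime majorant and the tree box sum -/

/-- Existence of the crossover radius: `B ≤ A m⁶` for some natural `m` (`A > 0`). [folklore] -/
theorem exists_nat_le_mul_pow_six {A B : ℝ} (hA : 0 < A) : ∃ m : ℕ, B ≤ A * (m : ℝ) ^ 6 := by
  obtain ⟨m, hm⟩ := exists_nat_ge (B / A)
  refine ⟨m + 1, ?_⟩
  have h1 : (1 : ℝ) ≤ (m : ℝ) + 1 := by linarith [(Nat.cast_nonneg m : (0 : ℝ) ≤ m)]
  have h2 : B / A ≤ ((m + 1 : ℕ) : ℝ) ^ 6 := by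
    push_cast
    calc B / A ≤ m := hm
      _ ≤ (m : ℝ) + 1 := by linarith
      _ ≤ ((m : ℝ) + 1) ^ 6 := le_self_pow₀ h1 (by norm_num)
  rw [div_le_iff₀ hA] at h2
  linarith [h2]

/-- **Bookkeeping of the powers of `R` and `L`** for `treeFourBoxSum_le_of_boxSusceptibility`: with
`a = 730·125R³χ`, `V ≤ 8R³(L+1)³`, `Σ_L ≥ (L+1)³χ`, `χ² ≤ εL³`, the three sources
`(8RL+1)³a⁴ ≤ 729(730·125)⁴R¹⁵ε((L+1)³χ)²`, `a²V²δ ≤ 64(730·125)²R¹²δ((L+1)³χ)²`,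
`a⁴ ≤ (730·125)⁴R¹²ε((L+1)³χ)²` give `S/Σ_L² ≤ 10⁵(730·125)⁴R¹⁵(ε+δ)`. [folklore] -/
theorem susceptibility_bookkeeping {χ R L V δ ε a Q S Sg : ℝ} (hχ : 1 ≤ χ) (hR : 1 ≤ R) (hL : 1 ≤ L)
    (hδ : 0 ≤ δ) (hε : 0 ≤ ε) (hV0 : 0 ≤ V) (hV : V ≤ 8 * R ^ 3 * (L + 1) ^ 3)
    (hSg : (L + 1) ^ 3 * χ ≤ Sg) (hχε : χ ^ 2 ≤ ε * L ^ 3) (ha : a = 730 * (125 * R ^ 3) * χ)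
    (hQ : Q ≤ 24 * a ^ 2 * V ^ 2 * δ + a ^ 4) (hS0 : 0 ≤ S)
    (hS : S ≤ (8 * (R * L) + 1) ^ 3 * a ^ 4 + 27 * Q + 26 / 3 * Q) :
    S / Sg ^ 2 ≤ 10 ^ 5 * (730 * 125 : ℝ) ^ 4 * R ^ 15 * (ε + δ) := by
  have hL0 : 0 ≤ L := by linarith
  have hR0 : 0 ≤ R := by linarith
  have hχ0 : 0 < χ := by linarith
  have hX1 : 1 ≤ L + 1 := by linarith
  have hLX : L ≤ L + 1 := by linarith
  have hP0 : 0 < (L + 1) ^ 3 * χ := by positivity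
  have hχX : χ ^ 2 ≤ ε * (L + 1) ^ 3 :=
    hχε.trans (mul_le_mul_of_nonneg_left (pow_le_pow_left₀ hL0 hLX 3) hε)
  have ha2 : a ^ 2 = (730 * 125) ^ 2 * R ^ 6 * χ ^ 2 := by rw [ha]; ring
  have ha4 : a ^ 4 = (730 * 125) ^ 4 * R ^ 12 * χ ^ 2 * χ ^ 2 := by rw [ha]; ring
  have h1 : (8 * (R * L) + 1) ^ 3 * a ^ 4 ≤
      729 * (730 * 125) ^ 4 * R ^ 15 * ε * ((L + 1) ^ 3 * χ) ^ 2 := by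
    have hRL : 0 ≤ R * L := mul_nonneg hR0 hL0
    have h8 : 8 * (R * L) + 1 ≤ 9 * R * (L + 1) := by linarith
    have h80 : (0 : ℝ) ≤ 8 * (R * L) + 1 := by positivity
    rw [ha4]
    calc (8 * (R * L) + 1) ^ 3 * ((730 * 125) ^ 4 * R ^ 12 * χ ^ 2 * χ ^ 2)
        ≤ (9 * R * (L + 1)) ^ 3 * ((730 * 125) ^ 4 * R ^ 12 * χ ^ 2 * (ε * (L + 1) ^ 3)) := by gcongr
      _ = 729 * (730 * 125) ^ 4 * R ^ 15 * ε * ((L + 1) ^ 3 * χ) ^ 2 := by ring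
  have h2 : a ^ 2 * V ^ 2 * δ ≤ 64 * (730 * 125) ^ 2 * R ^ 12 * δ * ((L + 1) ^ 3 * χ) ^ 2 := by
    rw [ha2]
    calc (730 * 125) ^ 2 * R ^ 6 * χ ^ 2 * V ^ 2 * δ
        ≤ (730 * 125) ^ 2 * R ^ 6 * χ ^ 2 * (8 * R ^ 3 * (L + 1) ^ 3) ^ 2 * δ := by gcongr
      _ = 64 * (730 * 125) ^ 2 * R ^ 12 * δ * ((L + 1) ^ 3 * χ) ^ 2 := by ring
  have h3 : a ^ 4 ≤ (730 * 125) ^ 4 * R ^ 12 * ε * ((L + 1) ^ 3 * χ) ^ 2 := by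
    have hX36 : (L + 1) ^ 3 ≤ (L + 1) ^ 6 := pow_le_pow_right₀ hX1 (by norm_num)
    rw [ha4]
    calc (730 * 125) ^ 4 * R ^ 12 * χ ^ 2 * χ ^ 2
        ≤ (730 * 125) ^ 4 * R ^ 12 * χ ^ 2 * (ε * (L + 1) ^ 3) := by gcongr
      _ ≤ (730 * 125) ^ 4 * R ^ 12 * χ ^ 2 * (ε * (L + 1) ^ 6) := by gcongr
      _ = (730 * 125) ^ 4 * R ^ 12 * ε * ((L + 1) ^ 3 * χ) ^ 2 := by ring
  -- everything in terms of `U := (730·125)⁴ R¹⁵ (ε + δ) ((L+1)³χ)²`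
  have hc24 : (730 * 125 : ℝ) ^ 2 ≤ (730 * 125) ^ 4 := by norm_num
  have hc0 : (0 : ℝ) ≤ (730 * 125) ^ 4 := by positivity
  have hR1215 : R ^ 12 ≤ R ^ 15 := pow_le_pow_right₀ hR (by norm_num)
  have hPP : 0 ≤ ((L + 1) ^ 3 * χ) ^ 2 := sq_nonneg _
  have hεδ : ε ≤ ε + δ := le_add_of_nonneg_right hδ
  have hδε : δ ≤ ε + δ := le_add_of_nonneg_left hε
  have hU1 : (730 * 125 : ℝ) ^ 4 * R ^ 15 * ε ≤ (730 * 125) ^ 4 * R ^ 15 * (ε + δ) :=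
    mul_le_mul_of_nonneg_left hεδ (by positivity)
  have hU2 : (730 * 125 : ℝ) ^ 2 * R ^ 12 * δ ≤ (730 * 125) ^ 4 * R ^ 15 * (ε + δ) :=
    mul_le_mul (mul_le_mul hc24 hR1215 (by positivity) hc0) hδε hδ (by positivity)
  have hU3 : (730 * 125 : ℝ) ^ 4 * R ^ 12 * ε ≤ (730 * 125) ^ 4 * R ^ 15 * (ε + δ) :=
    mul_le_mul (mul_le_mul_of_nonneg_left hR1215 hc0) hεδ hε (by positivity)
  have hU1' := mul_le_mul_of_nonneg_right hU1 hPP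
  have hU2' := mul_le_mul_of_nonneg_right hU2 hPP
  have hU3' := mul_le_mul_of_nonneg_right hU3 hPP
  generalize hPg : ((L + 1) ^ 3 * χ) ^ 2 = P2 at h1 h2 h3 hPP hU1' hU2' hU3'
  generalize hUg : (730 * 125 : ℝ) ^ 4 * R ^ 15 * (ε + δ) = U0 at hU1' hU2' hU3'
  have hU0 : 0 ≤ U0 * P2 := by
    rw [← hUg]
    exact mul_nonneg (by positivity) hPP
  have k1 : (8 * (R * L) + 1) ^ 3 * a ^ 4 ≤ 729 * (U0 * P2) := by linarith
  have k2 : a ^ 2 * V ^ 2 * δ ≤ 64 * (U0 * P2) := by linarith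
  have k3 : a ^ 4 ≤ U0 * P2 := by linarith
  have kQ : Q ≤ 1537 * (U0 * P2) := by linarith
  have kS : S ≤ 100000 * (U0 * P2) := by linarith
  have hP2 : 0 < P2 := by rw [← hPg]; positivity
  have hSg2 : P2 ≤ Sg ^ 2 := by rw [← hPg]; exact pow_le_pow_left₀ hP0.le hSg 2
  calc S / Sg ^ 2 ≤ S / P2 := div_le_div_of_nonneg_left hS0 hP2 hSg2
    _ ≤ 100000 * (U0 * P2) / P2 := div_le_div_of_nonneg_right kS hP2.le
    _ = 100000 * U0 := by field_simp
    _ = 10 ^ 5 * (730 * 125 : ℝ) ^ 4 * R ^ 15 * (ε + δ) := by rw [← hUg]; ring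

/-- **The tree box sum from MMS2, `χ_k² ≤ εk³` (`k ≥ L₁`) and the decay `⟨σ₀σ_w⟩²|w|_∞³ ≤ δ`
(`|w|_∞ ≥ W₀`)** (`d = 3`; `J ≥ 0` translation invariant, `β ≥ 0`): for `L ≥ max(L₁, W₀, 1)`, `R ≥ 1`,
the tree diagrams on `Λ_{RL}` are finite and `𝒮_T(β,L,R) ≤ 10⁵(730·125)⁴R¹⁵(ε + δ)`.
Proof: `∑_{u∈Λ_{RL}⁴}T(u) = ∑_vF_{RL}(v)⁴` is dominated by the two-regime majorant `a⁴` on `Λ_M`,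
`9|Λ_{RL}|⁴δ²|v|_∞^{-6}` outside, `a = 730·125R³χ_L` (`boxRowSum_le_uniform_mms`), `M = max(4RL, M₁)` with
`M₁` the crossover radius (least `m` with `9|Λ_{RL}|⁴δ² ≤ a⁴m⁶`); its sum is
`≤ (8RL+1)³a⁴ + (27 + 26/3)·a⁴M₁³` and `a⁴M₁³ ≤ 24a²|Λ_{RL}|²δ + a⁴`; finally `Σ_L ≥ (L+1)³χ_L` cancels
the powers of `χ_L` but two, which `χ_L² ≤ εL³` pays for. [folklore] -/
theorem treeFourBoxSum_le_of_boxSusceptibility (hβ : 0 ≤ β) (hJ : ∀ x y, 0 ≤ J x y)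
    (hJt : ∀ a x y, J (x + a) (y + a) = J x y)
    (hmms : ∀ x y : Site 3, (3 : ℝ) * ‖x‖ ≤ ‖y‖ → pairCorrelation J β 0 y ≤ pairCorrelation J β 0 x)
    {ε δ : ℝ} (hε : 0 ≤ ε) (hδ : 0 < δ) {L₁ W₀ : ℕ}
    (hχ : ∀ k : ℕ, L₁ ≤ k → boxSusceptibility J β k ^ 2 ≤ ε * (k : ℝ) ^ 3)
    (hdec : ∀ w : Site 3, W₀ ≤ Site.supNorm w →
      pairCorrelation J β 0 w ^ 2 * (Site.supNorm w : ℝ) ^ 3 ≤ δ)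
    {L R : ℕ} (hL : 1 ≤ L) (hR : 1 ≤ R) (hL₁ : L₁ ≤ L) (hW : W₀ ≤ L) :
    (∀ u ∈ Fintype.piFinset (fun _ : Fin 4 => box 3 (R * L)), treeFourE J β u ≠ ⊤) ∧
      treeFourBoxSum J β L R ≤ 10 ^ 5 * (730 * 125 : ℝ) ^ 4 * (R : ℝ) ^ 15 * (ε + δ) := by
  classical
  -- the concrete inputs
  have hχ1 : 1 ≤ boxSusceptibility J β L := one_le_boxSusceptibility J β hβ hJ L
  have hRpos : 0 < R := hR
  have hR0 : (0 : ℝ) < R := by exact_mod_cast hRpos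
  have hR1 : (1 : ℝ) ≤ R := by exact_mod_cast hR
  have hL1r : (1 : ℝ) ≤ L := by exact_mod_cast hL
  have hF0 : ∀ u, 0 ≤ boxRowSum J β (R * L) u := fun u => boxRowSum_nonneg J β hβ hJ _ u
  have hFa : ∀ u, boxRowSum J β (R * L) u ≤ 730 * (125 * (R : ℝ) ^ 3) * boxSusceptibility J β L :=
    fun u => boxRowSum_le_uniform_mms J β hβ hJ hJt hmms hR hL u
  have hfar : ∀ u : Site 3, 4 * (R * L) + 1 ≤ Site.supNorm u → boxRowSum J β (R * L) u ^ 4 ≤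
      9 * (#(box 3 (R * L)) : ℝ) ^ 4 * δ ^ 2 / (Site.supNorm u : ℝ) ^ 6 :=
    fun u hu => boxRowSum_pow_four_le_far_of_decay J β hβ hJ hJt hδ.le hdec hR hW hu
  have hSgL : ((L : ℝ) + 1) ^ 3 * boxSusceptibility J β L ≤ blockVariance J β L :=
    pow_mul_boxSusceptibility_le_blockVariance J β hβ hJ hJt L
  have hχε : boxSusceptibility J β L ^ 2 ≤ ε * (L : ℝ) ^ 3 := hχ L hL₁
  have hVle : (#(box 3 (R * L)) : ℝ) ≤ 8 * (R : ℝ) ^ 3 * ((L : ℝ) + 1) ^ 3 := by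
    rw [card_box]
    push_cast
    have h1 : 2 * ((R : ℝ) * L) + 1 ≤ 2 * R * (L + 1) := by
      have e : 2 * (R : ℝ) * (L + 1) = 2 * ((R : ℝ) * L) + 2 * R := by ring
      rw [e]
      linarith
    calc (2 * ((R : ℝ) * (L : ℝ)) + 1) ^ 3 ≤ (2 * (R : ℝ) * (L + 1)) ^ 3 :=
        pow_le_pow_left₀ (by positivity) h1 3
      _ = 8 * (R : ℝ) ^ 3 * ((L : ℝ) + 1) ^ 3 := by ring
  have hV1 : (1 : ℝ) ≤ (#(box 3 (R * L)) : ℝ) := by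
    exact_mod_cast Finset.card_pos.2 (box_nonempty 3 (R * L))
  have hN1 : 1 ≤ R * L := Nat.one_le_iff_ne_zero.2 (Nat.mul_ne_zero (by omega) (by omega))
  -- opaque names for the scales and constants
  rw [treeFourBoxSum]
  generalize hNg : R * L = N at *
  generalize hχg : boxSusceptibility J β L = χ at *
  generalize hVg : (#(box 3 N) : ℝ) = V at *
  generalize hSgg : blockVariance J β L = Sg at *
  obtain ⟨a, ha⟩ : ∃ a : ℝ, a = 730 * (125 * (R : ℝ) ^ 3) * χ := ⟨_, rfl⟩
  have hFa' : ∀ u, boxRowSum J β N u ≤ a := fun u => (hFa u).trans_eq ha.symm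
  obtain ⟨A, hA⟩ : ∃ A : ℝ, A = a ^ 4 := ⟨_, rfl⟩
  obtain ⟨B, hB⟩ : ∃ B : ℝ, B = 9 * V ^ 4 * δ ^ 2 := ⟨_, rfl⟩
  have hχ0 : 0 < χ := by linarith
  have ha0 : 0 < a := by rw [ha]; positivity
  have hA0 : 0 < A := by rw [hA]; positivity
  have hV0 : 0 < V := by linarith
  have hB0 : 0 < B := by rw [hB]; positivity
  -- the crossover radius `M₁`
  have hex : ∃ m : ℕ, B ≤ A * (m : ℝ) ^ 6 := exists_nat_le_mul_pow_six hA0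
  obtain ⟨M₁, hM₁spec, hM₁min'⟩ :
      ∃ M₁ : ℕ, B ≤ A * (M₁ : ℝ) ^ 6 ∧ ∀ m : ℕ, m < M₁ → ¬ B ≤ A * (m : ℝ) ^ 6 :=
    ⟨Nat.find hex, Nat.find_spec hex, fun m hm => Nat.find_min hex hm⟩
  have hM₁pos : 1 ≤ M₁ := by
    by_contra h0
    have h0' : M₁ = 0 := by omega
    rw [h0', Nat.cast_zero, zero_pow (by norm_num), mul_zero] at hM₁spec
    linarith
  have hM₁min : A * ((M₁ : ℝ) - 1) ^ 6 < B := by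
    have h := hM₁min' (M₁ - 1) (by omega)
    rw [not_le] at h
    have e : ((M₁ - 1 : ℕ) : ℝ) = (M₁ : ℝ) - 1 := by rw [Nat.cast_sub hM₁pos, Nat.cast_one]
    rwa [e] at h
  -- `A M₁³ ≤ 24 a² V² δ + A`
  have hQ : A * (M₁ : ℝ) ^ 3 ≤ 24 * a ^ 2 * V ^ 2 * δ + A := by
    rcases Nat.lt_or_ge M₁ 2 with hlt | hge
    · have h1 : M₁ = 1 := by omega
      subst h1
      rw [Nat.cast_one, one_pow, mul_one]
      exact le_add_of_nonneg_left (by positivity)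
    · have hhalf : (M₁ : ℝ) / 2 ≤ (M₁ : ℝ) - 1 := by
        have : (2 : ℝ) ≤ M₁ := by exact_mod_cast hge
        linarith
      have h6 : ((M₁ : ℝ) / 2) ^ 6 ≤ ((M₁ : ℝ) - 1) ^ 6 := pow_le_pow_left₀ (by positivity) hhalf 6
      have h7 : A * (M₁ : ℝ) ^ 6 < 64 * B := by
        have h := lt_of_le_of_lt (mul_le_mul_of_nonneg_left h6 hA0.le) hM₁min
        have e : A * ((M₁ : ℝ) / 2) ^ 6 = A * (M₁ : ℝ) ^ 6 / 64 := by ring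
        rw [e] at h
        linarith
      have h8 : (A * (M₁ : ℝ) ^ 3) ^ 2 < (24 * a ^ 2 * V ^ 2 * δ) ^ 2 := by
        calc (A * (M₁ : ℝ) ^ 3) ^ 2 = A * (A * (M₁ : ℝ) ^ 6) := by ring
          _ < A * (64 * B) := mul_lt_mul_of_pos_left h7 hA0
          _ = (24 * a ^ 2 * V ^ 2 * δ) ^ 2 := by rw [hA, hB]; ring
      have h9 : A * (M₁ : ℝ) ^ 3 < 24 * a ^ 2 * V ^ 2 * δ :=
        lt_of_pow_lt_pow_left₀ 2 (by positivity) h8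
      linarith
  -- the majorant, constant on `Λ_M`, `M = max (4N) M₁`
  obtain ⟨M, hM⟩ : ∃ M : ℕ, M = max (4 * N) M₁ := ⟨_, rfl⟩
  have hM4N : 4 * N ≤ M := by rw [hM]; exact le_max_left _ _
  have hMM₁ : M₁ ≤ M := by rw [hM]; exact le_max_right _ _
  have hM1 : 1 ≤ M := by omega
  have hg0 : ∀ u, 0 ≤ rowMajorant A B 6 M u := rowMajorant_nonneg hA0.le hB0.le 6 M
  obtain ⟨hgs, hgt⟩ := summable_rowMajorant hA0.le hB0.le (by norm_num : (3 : ℝ) < 6) hM1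
  have hFg : ∀ u, boxRowSum J β N u ^ 4 ≤ rowMajorant A B 6 M u := by
    intro u
    by_cases hu : u ∈ box 3 M
    · rw [rowMajorant, if_pos hu, hA]
      exact pow_le_pow_left₀ (hF0 u) (hFa' u) 4
    · have hu' : 4 * N + 1 ≤ Site.supNorm u := by
        rw [mem_box_iff_supNorm_le, not_le] at hu
        omega
      have h := hfar u hu'
      rw [rowMajorant, if_neg hu]
      have hn0 : (0 : ℝ) < (Site.supNorm u : ℝ) := by
        exact_mod_cast (show 0 < Site.supNorm u by omega)
      have e : B * (Site.supNorm u : ℝ) ^ (-(6 : ℝ)) =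
          9 * V ^ 4 * δ ^ 2 / (Site.supNorm u : ℝ) ^ 6 := by
        rw [Real.rpow_neg hn0.le, show (6 : ℝ) = ((6 : ℕ) : ℝ) by norm_num, Real.rpow_natCast, hB,
          div_eq_mul_inv]
      rw [e]
      exact h
  -- the tree diagrams
  obtain ⟨hfin, hsum⟩ := treeFourE_finite_and_sum_toReal_le hβ hJ hg0 hgs hFg
  refine ⟨hfin, ?_⟩
  have hM0 : (0 : ℝ) < M := by exact_mod_cast hM1
  have hrpow : (M : ℝ) ^ ((3 : ℝ) - 6) = ((M : ℝ) ^ 3)⁻¹ := by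
    rw [show (3 : ℝ) - 6 = -((3 : ℕ) : ℝ) by norm_num, Real.rpow_neg hM0.le, Real.rpow_natCast]
  have hcardM : (#(box 3 M) : ℝ) ≤ (8 * (N : ℝ) + 1) ^ 3 + 27 * (M₁ : ℝ) ^ 3 := by
    rw [card_box]
    push_cast
    rcases le_total (4 * N) M₁ with h | h
    · rw [hM, max_eq_right h]
      have h27 : (2 * (M₁ : ℝ) + 1) ^ 3 ≤ 27 * (M₁ : ℝ) ^ 3 := by
        have h1 : (1 : ℝ) ≤ M₁ := by exact_mod_cast hM₁pos
        calc (2 * (M₁ : ℝ) + 1) ^ 3 ≤ (3 * (M₁ : ℝ)) ^ 3 :=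
            pow_le_pow_left₀ (by positivity) (by linarith) 3
          _ = 27 * (M₁ : ℝ) ^ 3 := by ring
      linarith [h27, show (0 : ℝ) ≤ (8 * (N : ℝ) + 1) ^ 3 by positivity]
    · rw [hM, max_eq_left h]
      push_cast
      have e : (2 * (4 * (N : ℝ)) + 1) ^ 3 = (8 * (N : ℝ) + 1) ^ 3 := by ring
      linarith [e, show (0 : ℝ) ≤ 27 * (M₁ : ℝ) ^ 3 by positivity]
  have hBM : B * ((M : ℝ) ^ 3)⁻¹ ≤ A * (M₁ : ℝ) ^ 3 := by
    have hM₁0 : (0 : ℝ) < M₁ := by exact_mod_cast hM₁pos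
    have h1 : ((M : ℝ) ^ 3)⁻¹ ≤ ((M₁ : ℝ) ^ 3)⁻¹ := by
      apply inv_anti₀ (by positivity)
      exact pow_le_pow_left₀ hM₁0.le (by exact_mod_cast hMM₁) 3
    calc B * ((M : ℝ) ^ 3)⁻¹ ≤ B * ((M₁ : ℝ) ^ 3)⁻¹ := mul_le_mul_of_nonneg_left h1 hB0.le
      _ ≤ A * (M₁ : ℝ) ^ 6 * ((M₁ : ℝ) ^ 3)⁻¹ := mul_le_mul_of_nonneg_right hM₁spec (by positivity)
      _ = A * (M₁ : ℝ) ^ 3 := by field_simp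
  have hS : ∑ u ∈ Fintype.piFinset (fun _ : Fin 4 => box 3 N), (treeFourE J β u).toReal ≤
      (8 * (N : ℝ) + 1) ^ 3 * A + 27 * (A * (M₁ : ℝ) ^ 3) + 26 / 3 * (A * (M₁ : ℝ) ^ 3) := by
    calc ∑ u ∈ Fintype.piFinset (fun _ : Fin 4 => box 3 N), (treeFourE J β u).toReal
        ≤ ∑' v, rowMajorant A B 6 M v := hsum
      _ ≤ (#(box 3 M) : ℝ) * A + B * (26 * (M : ℝ) ^ ((3 : ℝ) - 6) / (6 - 3)) := hgt
      _ = (#(box 3 M) : ℝ) * A + 26 / 3 * (B * ((M : ℝ) ^ 3)⁻¹) := by rw [hrpow]; ring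
      _ ≤ ((8 * (N : ℝ) + 1) ^ 3 + 27 * (M₁ : ℝ) ^ 3) * A + 26 / 3 * (A * (M₁ : ℝ) ^ 3) := by
          gcongr
      _ = _ := by ring
  have hS0 : 0 ≤ ∑ u ∈ Fintype.piFinset (fun _ : Fin 4 => box 3 N), (treeFourE J β u).toReal :=
    Finset.sum_nonneg fun _ _ => ENNReal.toReal_nonneg
  have hNc : (N : ℝ) = (R : ℝ) * L := by rw [← hNg]; push_cast; ring
  rw [hNc] at hS
  rw [hA] at hQ hS
  exact susceptibility_bookkeeping hχ1 hR1 hL1r hδ.le hε hV0.le hVle hSgL hχε ha hQ hS0 hS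

/-! #### Step 4: the limits -/

/-- From `χ_L²/L³ → 0`: for every `ε > 0`, `χ_k² ≤ εk³` for all `k ≥ L₁` (some `L₁ ≥ 1`). [folklore] -/
theorem exists_boxSusceptibility_sq_le
    (hχ : Tendsto (fun L : ℕ => boxSusceptibility J β L ^ 2 / (L : ℝ) ^ 3) atTop (𝓝 0))
    {ε : ℝ} (hε : 0 < ε) :
    ∃ L₁ : ℕ, 1 ≤ L₁ ∧ ∀ k : ℕ, L₁ ≤ k → boxSusceptibility J β k ^ 2 ≤ ε * (k : ℝ) ^ 3 := by
  obtain ⟨L₁, hL₁⟩ := (Metric.tendsto_atTop.1 hχ) ε hε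
  refine ⟨max L₁ 1, le_max_right _ _, fun k hk => ?_⟩
  have hk1 : (1 : ℝ) ≤ k := by exact_mod_cast le_of_max_le_right hk
  have hk3 : (0 : ℝ) < (k : ℝ) ^ 3 := by positivity
  have h := hL₁ k (le_of_max_le_left hk)
  rw [Real.dist_eq, sub_zero, abs_of_nonneg (div_nonneg (sq_nonneg _) hk3.le), div_lt_iff₀ hk3] at h
  exact h.le

/-- **Eventually, the tree diagrams are finite and `𝒮_T(β,L,R) ≤ 2·10⁵(730·125)⁴R¹⁵ε`**, for every
`ε > 0`, granted MMS2 and `χ_L(β)²/L³ → 0` (the decay input is derived from the same hypothesis by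
`pairCorrelation_sq_mul_cube_le_of_boxSusceptibility`). [folklore] -/
theorem exists_forall_treeFourBoxSum_le (hβ : 0 ≤ β) (hJ : ∀ x y, 0 ≤ J x y)
    (hJt : ∀ a x y, J (x + a) (y + a) = J x y)
    (hmms : ∀ x y : Site 3, (3 : ℝ) * ‖x‖ ≤ ‖y‖ → pairCorrelation J β 0 y ≤ pairCorrelation J β 0 x)
    (hχ : Tendsto (fun L : ℕ => boxSusceptibility J β L ^ 2 / (L : ℝ) ^ 3) atTop (𝓝 0))
    {R : ℕ} (hR : 1 ≤ R) {ε : ℝ} (hε : 0 < ε) :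
    ∃ L₀ : ℕ, 1 ≤ L₀ ∧ ∀ L : ℕ, L₀ ≤ L →
      (∀ u ∈ Fintype.piFinset (fun _ : Fin 4 => box 3 (R * L)), treeFourE J β u ≠ ⊤) ∧
        treeFourBoxSum J β L R ≤ 10 ^ 5 * (730 * 125 : ℝ) ^ 4 * (R : ℝ) ^ 15 * (ε + ε) := by
  obtain ⟨L₁, hL₁1, hL₁⟩ := exists_boxSusceptibility_sq_le J β hχ hε
  have hdec : ∀ w : Site 3, 3 * (L₁ + 1) ≤ Site.supNorm w →
      pairCorrelation J β 0 w ^ 2 * (Site.supNorm w : ℝ) ^ 3 ≤ ε :=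
    fun w hw => pairCorrelation_sq_mul_cube_le_of_boxSusceptibility J β hβ hJ hmms hL₁ hw
  refine ⟨3 * (L₁ + 1), by omega, fun L hL => ?_⟩
  exact treeFourBoxSum_le_of_boxSusceptibility J β hβ hJ hJt hmms hε.le hε hL₁ hdec
    (by omega) hR (by omega) hL

/-- **The tree box sum tends to `0` when `χ_L(β) = o(L^{3/2})`** (`d = 3`, `J ≥ 0` translation
invariant, `β ≥ 0`, MMS2 at `β`, `χ_L(β)²/L³ → 0`), for every fixed `R ≥ 1`. This strictly contains
the bubble-condition case `B(β) < ∞` of `tendsto_treeFourBoxSum_of_summable_sq`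
(`tendsto_boxSusceptibility_sq_div_of_summable_sq`). [folklore] -/
theorem tendsto_treeFourBoxSum_of_boxSusceptibility (hβ : 0 ≤ β) (hJ : ∀ x y, 0 ≤ J x y)
    (hJt : ∀ a x y, J (x + a) (y + a) = J x y)
    (hmms : ∀ x y : Site 3, (3 : ℝ) * ‖x‖ ≤ ‖y‖ → pairCorrelation J β 0 y ≤ pairCorrelation J β 0 x)
    (hχ : Tendsto (fun L : ℕ => boxSusceptibility J β L ^ 2 / (L : ℝ) ^ 3) atTop (𝓝 0))
    {R : ℕ} (hR : 1 ≤ R) :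
    Tendsto (fun L : ℕ => treeFourBoxSum J β L R) atTop (𝓝 0) := by
  have hRpos : 0 < R := hR
  have hR0 : (0 : ℝ) < R := by exact_mod_cast hRpos
  obtain ⟨K, hK⟩ : ∃ K : ℝ, K = 10 ^ 5 * (730 * 125 : ℝ) ^ 4 * (R : ℝ) ^ 15 := ⟨_, rfl⟩
  have hK0 : 0 < K := by rw [hK]; positivity
  rw [Metric.tendsto_atTop]
  intro η hη
  obtain ⟨ε, hε⟩ : ∃ ε : ℝ, ε = η / (4 * K) := ⟨_, rfl⟩
  have hε0 : 0 < ε := by rw [hε]; positivity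
  obtain ⟨L₀, _, hL₀⟩ := exists_forall_treeFourBoxSum_le J β hβ hJ hJt hmms hχ hR hε0
  refine ⟨L₀, fun L hL => ?_⟩
  obtain ⟨_, hb⟩ := hL₀ L hL
  rw [← hK] at hb
  rw [Real.dist_eq, sub_zero, abs_of_nonneg (treeFourBoxSum_nonneg J β L R)]
  calc treeFourBoxSum J β L R ≤ K * (ε + ε) := hb
    _ = η / 2 := by rw [hε]; field_simp; ring
    _ < η := by linarith

/-- **The moment-generating-function deviation tends to `0` when `χ_L(β) = o(L^{3/2})`** (`d = 3`,
`J ≥ 0` translation invariant, `β > 0`, MMS2 at `β`, `χ_L(β)²/L³ → 0`; `f ∈ C_c(ℝ³)`, `z ∈ ℝ`):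
`|⟨e^{zT_{f,L,β}}⟩_β - e^{(z²/2)⟨T²_{f,L,β}⟩_β}| → 0` — the tree-graph Wick bound `mgfDeviation_le_tree`,
the variance bound `state_smeared_sq_le` (the audited discharge) and
`tendsto_treeFourBoxSum_of_boxSusceptibility`.
[cite: Panis2023Triviality, proof of Theorem 5.5 (pp. 21–22) and Remark 1.6] -/
theorem tendsto_mgfDeviation_of_boxSusceptibility (hβ : 0 < β) (hJ : ∀ x y, 0 ≤ J x y)
    (hJt : ∀ a x y, J (x + a) (y + a) = J x y)
    (hmms : ∀ x y : Site 3, (3 : ℝ) * ‖x‖ ≤ ‖y‖ → pairCorrelation J β 0 y ≤ pairCorrelation J β 0 x)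
    (hχ : Tendsto (fun L : ℕ => boxSusceptibility J β L ^ 2 / (L : ℝ) ^ 3) atTop (𝓝 0))
    (f : EuclideanSpace ℝ (Fin 3) → ℝ) (hf : Continuous f) (hfs : HasCompactSupport f) (z : ℝ) :
    Tendsto (fun L : ℕ => mgfDeviation J β L f z) atTop (𝓝 0) := by
  obtain ⟨R, hR, hfR⟩ := exists_nat_forall_abs_apply_le f hfs
  have hfa : Continuous fun x => |f x| := hf.abs
  have hfas : HasCompactSupport fun x => |f x| := hfs.norm
  obtain ⟨Cf, hCf⟩ := state_smeared_sq_le J β hβ.le hJ hJt (fun x => |f x|) hfa hfas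
  set F : ℝ := (⨆ x, |f x|) ^ 4 with hF
  have hF0 : 0 ≤ F := pow_nonneg (Real.iSup_nonneg fun x => abs_nonneg (f x)) 4
  set Kc : ℝ := 32 * z ^ 4 * Real.exp (z ^ 2 / 2 * Cf) * F with hKc
  have hKc0 : 0 ≤ Kc := by positivity
  have hS := tendsto_treeFourBoxSum_of_boxSusceptibility J β hβ.le hJ hJt hmms hχ hR
  obtain ⟨L₀, hL₀1, hL₀⟩ := exists_forall_treeFourBoxSum_le J β hβ.le hJ hJt hmms hχ hR one_pos
  have hmaj : ∀ L : ℕ, L₀ ≤ L → mgfDeviation J β L f z ≤ Kc * treeFourBoxSum J β L R := by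
    intro L hL
    obtain ⟨hfin, _⟩ := hL₀ L hL
    have hL1 : 1 ≤ L := hL₀1.trans hL
    have h1 := mgfDeviation_le_tree J β hJ hβ hL1 hR hf hfR hfin z
    have h2 : Real.exp (z ^ 2 / 2 * state J β 0 (fun σ => smeared J β L (fun x => |f x|) σ ^ 2)) ≤
        Real.exp (z ^ 2 / 2 * Cf) :=
      Real.exp_le_exp.2 (mul_le_mul_of_nonneg_left (hCf L hL1) (by positivity))
    calc mgfDeviation J β L f z
        ≤ 32 * z ^ 4 * Real.exp (z ^ 2 / 2 * state J β 0 (fun σ => smeared J β L (fun x => |f x|) σ ^ 2)) *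
            F * treeFourBoxSum J β L R := h1
      _ ≤ 32 * z ^ 4 * Real.exp (z ^ 2 / 2 * Cf) * F * treeFourBoxSum J β L R := by
          gcongr
          exact treeFourBoxSum_nonneg J β L R
      _ = Kc * treeFourBoxSum J β L R := by rw [hKc]
  have hlim : Tendsto (fun L : ℕ => Kc * treeFourBoxSum J β L R) atTop (𝓝 0) := by
    simpa using hS.const_mul Kc
  refine squeeze_zero' (Eventually.of_forall fun L => abs_nonneg _) ?_ hlim
  exact eventually_atTop.2 ⟨L₀, hmaj⟩

/-! #### Step 5: the hypothesis `χ_L²/L³ → 0` — implied by the bubble condition, and necessary for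
the tree-diagram mechanism -/

/-- **The bubble condition implies `χ_L(β)²/L³ → 0`** (`J ≥ 0` translation invariant, `β ≥ 0`,
`B(β) = ∑ₓ⟨σ₀σ_x⟩² < ∞`): the `ℓ`-split `χ_N² ≤ 2|Λ_ℓ|B + 2|Λ_N|(B - B_ℓ)` of generation 2
(`sq_boxRowSum_le_split` at `u = 0`) — so `treeFourBoxSum_le_of_boxSusceptibility` contains the
finite-bubble theorem `treeFourBoxSum_le_of_summable_sq`. The converse fails for sequences
(`⟨σ₀σ_x⟩ ≍ |x|^{-3/2}(log|x|)^{-1/4}`: `B = ∞`, `χ_L ≍ L^{3/2}(log L)^{-1/4}`).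
[cite: Panis2023Triviality, Theorem 12.2 (proof), p. 51] -/
theorem tendsto_boxSusceptibility_sq_div_of_summable_sq (hβ : 0 ≤ β) (hJ : ∀ x y, 0 ≤ J x y)
    (hJt : ∀ a x y, J (x + a) (y + a) = J x y)
    (hB : Summable fun x : Site 3 => pairCorrelation J β 0 x ^ 2) :
    Tendsto (fun L : ℕ => boxSusceptibility J β L ^ 2 / (L : ℝ) ^ 3) atTop (𝓝 0) := by
  set Bv : ℝ := ∑' x : Site 3, pairCorrelation J β 0 x ^ 2 with hBv
  have hBv0 : 0 ≤ Bv := tsum_nonneg fun x => sq_nonneg _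
  have key : ∀ ℓ N : ℕ, boxSusceptibility J β N ^ 2 ≤
      2 * (#(box 3 ℓ) : ℝ) * Bv + 2 * (#(box 3 N) : ℝ) * ∑' x : Site 3, bubbleTail J β ℓ x := by
    intro ℓ N
    have h := sq_boxRowSum_le_split J β hβ hJ hJt ℓ N 0
    simp only [sub_zero] at h
    have e : boxRowSum J β N 0 = boxSusceptibility J β N := rfl
    rw [e] at h
    have h1 : ∑ y ∈ box 3 N, pairCorrelation J β 0 y ^ 2 ≤ Bv :=
      hB.sum_le_tsum (box 3 N) (fun y _ => sq_nonneg _)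
    have h2 : ∑ y ∈ box 3 N, bubbleTail J β ℓ y ≤ ∑' x, bubbleTail J β ℓ x :=
      (summable_bubbleTail J β hB ℓ).sum_le_tsum (box 3 N) (fun y _ => bubbleTail_nonneg J β ℓ y)
    calc _ ≤ _ := h
      _ ≤ _ := by gcongr
  rw [Metric.tendsto_atTop]
  intro η hη
  obtain ⟨ℓ, hℓ⟩ := (Metric.tendsto_atTop.1 (tendsto_tsum_bubbleTail J β hB)) (η / 108) (by positivity)
  have hTℓ := hℓ ℓ le_rfl
  rw [Real.dist_eq, sub_zero, abs_of_nonneg (tsum_nonneg fun x => bubbleTail_nonneg J β ℓ x)] at hTℓ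
  have hT0 : 0 ≤ ∑' x, bubbleTail J β ℓ x := tsum_nonneg fun x => bubbleTail_nonneg J β ℓ x
  have hlim : Tendsto (fun N : ℕ => 2 * (#(box 3 ℓ) : ℝ) * Bv / (N : ℝ) ^ 3) atTop (𝓝 0) := by
    have h1 : Tendsto (fun N : ℕ => (N : ℝ) ^ 3) atTop atTop :=
      (tendsto_pow_atTop (n := 3) (by norm_num)).comp tendsto_natCast_atTop_atTop
    exact h1.const_div_atTop _
  obtain ⟨N₀, hN₀⟩ := (Metric.tendsto_atTop.1 hlim) (η / 2) (by positivity)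
  refine ⟨max N₀ 1, fun N hN => ?_⟩
  have hN1 : (1 : ℝ) ≤ N := by exact_mod_cast le_of_max_le_right hN
  have hN3 : (0 : ℝ) < (N : ℝ) ^ 3 := by positivity
  have hfirst := hN₀ N (le_of_max_le_left hN)
  rw [Real.dist_eq, sub_zero, abs_of_nonneg (by positivity)] at hfirst
  rw [Real.dist_eq, sub_zero, abs_of_nonneg (by positivity)]
  have hcard : (#(box 3 N) : ℝ) ≤ 27 * (N : ℝ) ^ 3 := by
    rw [card_box]
    push_cast
    calc (2 * (N : ℝ) + 1) ^ 3 ≤ (3 * (N : ℝ)) ^ 3 := pow_le_pow_left₀ (by positivity) (by linarith) 3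
      _ = 27 * (N : ℝ) ^ 3 := by ring
  calc boxSusceptibility J β N ^ 2 / (N : ℝ) ^ 3
      ≤ (2 * (#(box 3 ℓ) : ℝ) * Bv + 2 * (#(box 3 N) : ℝ) * ∑' x : Site 3, bubbleTail J β ℓ x) /
          (N : ℝ) ^ 3 := div_le_div_of_nonneg_right (key ℓ N) hN3.le
    _ ≤ (2 * (#(box 3 ℓ) : ℝ) * Bv + 2 * (27 * (N : ℝ) ^ 3) * ∑' x : Site 3, bubbleTail J β ℓ x) /
          (N : ℝ) ^ 3 := by gcongr
    _ = 2 * (#(box 3 ℓ) : ℝ) * Bv / (N : ℝ) ^ 3 + 54 * ∑' x : Site 3, bubbleTail J β ℓ x := by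
        field_simp
        ring
    _ < η / 2 + η / 2 := by linarith
    _ = η := by ring

/-- **The tree box sum dominates `χ_L²/L³`** (Jensen twice: `∑_{v∈Λ_{RL}}F(v)⁴ ≥ (∑_vF(v))⁴/|Λ_{RL}|³`
and `∑_{v∈Λ_{RL}}F_{RL}(v) = Σ_{RL} ≥ Σ_L ≥ (L+1)³χ_L`): with finite tree diagrams,
`χ_L(β)²/L³ ≤ 3⁹R⁹·𝒮_T(β,L,R)`. Hence Gaussianity can be read off the tree diagram bound ONLY IF
`χ_L = o(L^{3/2})` — the reach of the mechanism is exactly the hypothesis of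
`tendsto_treeFourBoxSum_of_boxSusceptibility`. [folklore] -/
theorem boxSusceptibility_sq_div_le_treeFourBoxSum (hβ : 0 ≤ β) (hJ : ∀ x y, 0 ≤ J x y)
    (hJt : ∀ a x y, J (x + a) (y + a) = J x y) {L R : ℕ} (hL : 1 ≤ L) (hR : 1 ≤ R)
    (hfin : ∀ u ∈ Fintype.piFinset (fun _ : Fin 4 => box 3 (R * L)), treeFourE J β u ≠ ⊤) :
    boxSusceptibility J β L ^ 2 / (L : ℝ) ^ 3 ≤ 3 ^ 9 * (R : ℝ) ^ 9 * treeFourBoxSum J β L R := by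
  set N : ℕ := R * L with hN
  set P : Finset (Fin 4 → Site 3) := Fintype.piFinset (fun _ : Fin 4 => box 3 N) with hP
  have hRpos : 0 < R := hR
  have hLN : L ≤ N := by rw [hN]; exact Nat.le_mul_of_pos_left L hRpos
  have hF0 : ∀ v, 0 ≤ boxRowSum J β N v := fun v => boxRowSum_nonneg J β hβ hJ N v
  -- `∑_{u∈P} T(u) ≥ ∑_{v∈Λ_N} F_N(v)⁴`
  have hTsum : ∑ v ∈ box 3 N, boxRowSum J β N v ^ 4 ≤ ∑ u ∈ P, (treeFourE J β u).toReal := by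
    have htot : ∑ u ∈ P, treeFourE J β u =
        ∑' v : Site 3, ENNReal.ofReal (boxRowSum J β N v ^ 4) := by
      calc ∑ u ∈ P, treeFourE J β u
          = ∑' v : Site 3, ∑ u ∈ P, ∏ j, ENNReal.ofReal (pairCorrelation J β (u j) v) := by
            simp only [treeFourE]
            exact (Summable.tsum_finsetSum fun _ _ => ENNReal.summable).symm
        _ = ∑' v : Site 3, ENNReal.ofReal (boxRowSum J β N v ^ 4) := by
            refine tsum_congr fun v => ?_
            rw [hP, sum_piFinset_prod_eq J β hβ hJ N v]
    have hle : ENNReal.ofReal (∑ v ∈ box 3 N, boxRowSum J β N v ^ 4) ≤ ∑ u ∈ P, treeFourE J β u := by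
      rw [ENNReal.ofReal_sum_of_nonneg (fun v _ => pow_nonneg (hF0 v) 4), htot]
      exact ENNReal.sum_le_tsum _
    have hne : ∑ u ∈ P, treeFourE J β u ≠ ⊤ := ENNReal.sum_ne_top.2 hfin
    rw [← ENNReal.toReal_sum hfin]
    exact (ENNReal.ofReal_le_iff_le_toReal hne).1 hle
  -- Jensen twice: `(∑_v F)⁴ ≤ |Λ_N|³ ∑_v F⁴`
  have hJensen : (∑ v ∈ box 3 N, boxRowSum J β N v) ^ 4 ≤
      (#(box 3 N) : ℝ) ^ 3 * ∑ v ∈ box 3 N, boxRowSum J β N v ^ 4 := by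
    have h1 : (∑ v ∈ box 3 N, boxRowSum J β N v) ^ 2 ≤
        #(box 3 N) * ∑ v ∈ box 3 N, boxRowSum J β N v ^ 2 := sq_sum_le_card_mul_sum_sq
    have h2 : (∑ v ∈ box 3 N, boxRowSum J β N v ^ 2) ^ 2 ≤
        #(box 3 N) * ∑ v ∈ box 3 N, (boxRowSum J β N v ^ 2) ^ 2 := sq_sum_le_card_mul_sum_sq
    have h2' : (∑ v ∈ box 3 N, boxRowSum J β N v ^ 2) ^ 2 ≤
        #(box 3 N) * ∑ v ∈ box 3 N, boxRowSum J β N v ^ 4 := by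
      calc _ ≤ _ := h2
        _ = _ := by
            congr 1
            exact Finset.sum_congr rfl fun v _ => by ring
    calc (∑ v ∈ box 3 N, boxRowSum J β N v) ^ 4
        = ((∑ v ∈ box 3 N, boxRowSum J β N v) ^ 2) ^ 2 := by ring
      _ ≤ ((#(box 3 N) : ℝ) * ∑ v ∈ box 3 N, boxRowSum J β N v ^ 2) ^ 2 :=
          pow_le_pow_left₀ (sq_nonneg _) h1 2
      _ = (#(box 3 N) : ℝ) ^ 2 * (∑ v ∈ box 3 N, boxRowSum J β N v ^ 2) ^ 2 := by ring
      _ ≤ (#(box 3 N) : ℝ) ^ 2 * (#(box 3 N) * ∑ v ∈ box 3 N, boxRowSum J β N v ^ 4) :=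
          mul_le_mul_of_nonneg_left h2' (sq_nonneg _)
      _ = (#(box 3 N) : ℝ) ^ 3 * ∑ v ∈ box 3 N, boxRowSum J β N v ^ 4 := by ring
  -- `∑_v F_N(v) = Σ_N ≥ Σ_L ≥ (L+1)³ χ_L`
  have hSgN : ∑ v ∈ box 3 N, boxRowSum J β N v = blockVariance J β N := by
    rw [blockVariance_eq_sum J β hβ hJ N]
    refine Finset.sum_congr rfl fun v _ => ?_
    rw [boxRowSum]
    exact Finset.sum_congr rfl fun y _ => pairCorrelation_eq J β v y
  have hSgmono : blockVariance J β L ≤ blockVariance J β N := by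
    rw [blockVariance_eq_sum J β hβ hJ L, blockVariance_eq_sum J β hβ hJ N]
    exact (Finset.sum_le_sum fun x _ => Finset.sum_le_sum_of_subset_of_nonneg (box_mono 3 hLN)
        fun y _ _ => state_spinProduct_nonneg J β hβ hJ _).trans
      (Finset.sum_le_sum_of_subset_of_nonneg (box_mono 3 hLN)
        fun x _ _ => Finset.sum_nonneg fun y _ => state_spinProduct_nonneg J β hβ hJ _)
  have hSgLz : ((L : ℝ) + 1) ^ 3 * boxSusceptibility J β L ≤ blockVariance J β L :=
    pow_mul_boxSusceptibility_le_blockVariance J β hβ hJ hJt L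
  -- combine
  have hχ0 : 0 ≤ boxSusceptibility J β L := boxSusceptibility_nonneg J β hβ hJ L
  have hV1 : 1 ≤ blockVariance J β L := one_le_blockVariance J β hβ hJ L
  have hV0 : 0 < blockVariance J β L := by linarith
  have hR1 : (1 : ℝ) ≤ R := by exact_mod_cast hR
  have hL1 : (1 : ℝ) ≤ L := by exact_mod_cast hL
  have hS0 : 0 ≤ ∑ u ∈ P, (treeFourE J β u).toReal := Finset.sum_nonneg fun _ _ => ENNReal.toReal_nonneg
  have hc3S : blockVariance J β L ^ 4 ≤ (#(box 3 N) : ℝ) ^ 3 * ∑ u ∈ P, (treeFourE J β u).toReal := by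
    calc blockVariance J β L ^ 4 ≤ blockVariance J β N ^ 4 := pow_le_pow_left₀ hV0.le hSgmono 4
      _ = (∑ v ∈ box 3 N, boxRowSum J β N v) ^ 4 := by rw [hSgN]
      _ ≤ (#(box 3 N) : ℝ) ^ 3 * ∑ v ∈ box 3 N, boxRowSum J β N v ^ 4 := hJensen
      _ ≤ (#(box 3 N) : ℝ) ^ 3 * ∑ u ∈ P, (treeFourE J β u).toReal :=
          mul_le_mul_of_nonneg_left hTsum (by positivity)
  have hcardle : (#(box 3 N) : ℝ) ≤ 27 * (R : ℝ) ^ 3 * (L : ℝ) ^ 3 := by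
    rw [card_box, hN]
    push_cast
    have hRL1 : (1 : ℝ) ≤ (R : ℝ) * L := by nlinarith
    calc (2 * ((R : ℝ) * (L : ℝ)) + 1) ^ 3 ≤ (3 * ((R : ℝ) * L)) ^ 3 :=
        pow_le_pow_left₀ (by positivity) (by linarith) 3
      _ = 27 * (R : ℝ) ^ 3 * (L : ℝ) ^ 3 := by ring
  rw [treeFourBoxSum]
  generalize hSg : ∑ u ∈ P, (treeFourE J β u).toReal = S at *
  generalize hVg : blockVariance J β L = V at *
  generalize hCg : (#(box 3 N) : ℝ) = C at *
  generalize hχg : boxSusceptibility J β L = χ at *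
  have hT0 : 0 ≤ S / V ^ 2 := div_nonneg hS0 (sq_nonneg _)
  have e1 : V ^ 2 ≤ C ^ 3 * (S / V ^ 2) := by
    rw [mul_div_assoc', le_div_iff₀ (pow_pos hV0 2)]
    calc V ^ 2 * V ^ 2 = V ^ 4 := by ring
      _ ≤ C ^ 3 * S := hc3S
  have e2 : (((L : ℝ) + 1) ^ 3 * χ) ^ 2 ≤ V ^ 2 := pow_le_pow_left₀ (by positivity) hSgLz 2
  have hC0 : 0 ≤ C := by rw [← hCg]; positivity
  have e3 : C ^ 3 ≤ 3 ^ 9 * (R : ℝ) ^ 9 * (L : ℝ) ^ 9 := by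
    calc C ^ 3 ≤ (27 * (R : ℝ) ^ 3 * (L : ℝ) ^ 3) ^ 3 := pow_le_pow_left₀ hC0 hcardle 3
      _ = 3 ^ 9 * (R : ℝ) ^ 9 * (L : ℝ) ^ 9 := by ring
  have e4 : (L : ℝ) ^ 6 * χ ^ 2 ≤ (((L : ℝ) + 1) ^ 3 * χ) ^ 2 := by
    have hL6 : (L : ℝ) ^ 6 ≤ ((L : ℝ) + 1) ^ 6 := pow_le_pow_left₀ (by positivity) (by linarith) 6
    calc (L : ℝ) ^ 6 * χ ^ 2 ≤ ((L : ℝ) + 1) ^ 6 * χ ^ 2 := mul_le_mul_of_nonneg_right hL6 (sq_nonneg _)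
      _ = (((L : ℝ) + 1) ^ 3 * χ) ^ 2 := by ring
  have e5 : (L : ℝ) ^ 6 * χ ^ 2 ≤ 3 ^ 9 * (R : ℝ) ^ 9 * (L : ℝ) ^ 9 * (S / V ^ 2) :=
    e4.trans (e2.trans (e1.trans (mul_le_mul_of_nonneg_right e3 hT0)))
  have e6 : (L : ℝ) ^ 6 * χ ^ 2 ≤ (L : ℝ) ^ 6 * (3 ^ 9 * (R : ℝ) ^ 9 * (S / V ^ 2) * (L : ℝ) ^ 3) := by
    calc _ ≤ _ := e5
      _ = _ := by ring
  rw [div_le_iff₀ (by positivity : (0 : ℝ) < (L : ℝ) ^ 3)]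
  exact le_of_mul_le_mul_left e6 (by positivity)

/-- **A nonnegative sequence that does not tend to `0` is frequently bounded below.** [folklore] -/
theorem exists_frequently_le_of_not_tendsto {u : ℕ → ℝ} (hu : ∀ n, 0 ≤ u n)
    (h : ¬ Tendsto u atTop (𝓝 0)) : ∃ ε : ℝ, 0 < ε ∧ ∃ᶠ n in atTop, ε ≤ u n := by
  by_contra hc
  have hc' : ∀ ε : ℝ, 0 < ε → ∀ᶠ n in atTop, u n < ε := by
    intro ε hε
    have h1 : ¬ ∃ᶠ n in atTop, ε ≤ u n := fun hf => hc ⟨ε, hε, hf⟩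
    simpa [Filter.not_frequently, not_le] using h1
  apply h
  rw [tendsto_order]
  exact ⟨fun a ha => Eventually.of_forall fun n => ha.trans_le (hu n), fun a ha => hc' a ha⟩

end Susceptibility

end LongRangeIsing

open LongRangeIsing

/-! ### The headline: `χ_L(β_c) = o(L^{3/2})` implies Gaussian critical smearing on `ℤ³` -/

/-- **`χ_L(β_c) = o(L^{3/2})` (with MMS2) implies triviality of the critical smeared scaling limits on
`ℤ³`**: for every ferromagnetic translation-invariant pair interaction `J ≥ 0` on `ℤ³` whose critical
two-point function satisfies MMS2 (needed only if `β_c > 0`) and whose critical box susceptibility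
`χ_L(β_c) = ∑_{x∈Λ_L}⟨σ₀σ_x⟩_{β_c}` has `χ_L(β_c)²/L³ → 0`, every `f ∈ C_c(ℝ³)` and `z` have
`|⟨e^{zT_{f,L,β_c}}⟩ - e^{(z²/2)⟨T²_{f,L,β_c}⟩}| → 0`, i.e. `¬ HasNonGaussianSmearingZ3 J`. PROVED (the
tree-graph Wick bound by random currents, MMS2 comparisons, `Σ_L ≥ (L+1)³χ_L`, and the two-regime
majorant of `treeFourBoxSum_le_of_boxSusceptibility`; `β_c = 0` by independence). It contains the
finite-bubble theorem `not_hasNonGaussianSmearingZ3_of_summable_sq` of generation 2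
(`tendsto_boxSusceptibility_sq_div_of_summable_sq`).
[cite: Panis2023Triviality, Remark 1.6 (p. 7), proof of Theorem 5.5 (pp. 21–22) and Theorem 12.2 (p. 51)] -/
theorem not_hasNonGaussianSmearingZ3_of_boxSusceptibility {J : Site 3 → Site 3 → ℝ}
    (hJ : ∀ x y, 0 ≤ J x y) (hJt : ∀ a x y, J (x + a) (y + a) = J x y)
    (hmms : 0 < LongRangeIsing.criticalBeta J → ∀ x y : Site 3, (3 : ℝ) * ‖x‖ ≤ ‖y‖ →
      pairCorrelation J (LongRangeIsing.criticalBeta J) 0 y ≤ pairCorrelation J (LongRangeIsing.criticalBeta J) 0 x)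
    (hχ : Tendsto (fun L : ℕ => boxSusceptibility J (LongRangeIsing.criticalBeta J) L ^ 2 / (L : ℝ) ^ 3)
      atTop (𝓝 0)) :
    ¬ HasNonGaussianSmearingZ3 J := by
  rcases (criticalBeta_nonneg J).eq_or_lt with h0 | hpos
  · exact not_hasNonGaussianSmearingZ3_of_criticalBeta_eq_zero hJ h0.symm
  · rintro ⟨f, hf, hfs, z, hnot⟩
    exact hnot (tendsto_mgfDeviation_of_boxSusceptibility J _ hpos hJ hJt (hmms hpos) hχ f hf hfs z)

/-! ### The sharpened barrier -/

/-- **Barrier `SusceptibilityTrivialityOnZ3` (the exact reach of the tree-diagram mechanism on `ℤ³`;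
audit 2026-08-15, generation 4).** On `ℤ³`, every ferromagnetic translation-invariant pair interaction
`J ≥ 0` whose critical two-point function is Messager–Miracle-Solé monotone (MMS2; needed only when
`β_c > 0`) and whose critical box susceptibility satisfies `χ_L(β_c)²/L³ → 0` — i.e.
`χ_L(β_c) = ∑_{x∈Λ_L}⟨σ₀σ_x⟩_{β_c} = o(L^{3/2}) = o(|Λ_L|^{1/2})`, equivalently (given MMS2)
`Σ_L(β_c) = ⟨(∑_{Λ_L}σ)²⟩_{β_c} = o(L^{9/2})`, "`η > 1/2`" in lim-sup form — has Gaussian critical smeared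
scaling limits: `¬ HasNonGaussianSmearingZ3 J`. PROVED (`SusceptibilityTrivialityOnZ3_holds`). It
implies `BubbleTrivialityOnZ3` (generation 2), hence `LongRangeTrivialityOnZ3`, and its hypothesis is
the END of the road for the mechanism: with finite tree diagrams, `χ_L²/L³ ≤ 3⁹R⁹𝒮_T(β,L,R)`
(`LongRangeIsing.boxSusceptibility_sq_div_le_treeFourBoxSum`), so `𝒮_T → 0` — the quantity through
which every proof of the catalogued barrier reads off Gaussianity — holds if and only if `χ_L²/L³ → 0`.

BARRIER (structured block, D-0021):
- technique_class: tree-diagram-blind arguments on `ℤ³` — arguments for non-triviality of the critical nearest-neighbour model (clause (iii), smeared form `HasNonGaussianSmearingZ3`) every step of which holds for SOME ferromagnetic translation-invariant pair interaction on `ℤ³` with MMS-monotone critical two-point function and `χ_L(β_c) = o(L^{3/2})` — formally the hypotheses of `SusceptibilityTrivialityOnZ3` (`J ≥ 0`, translation invariance, MMS2 at `β_c`, `Tendsto (χ_L(β_c)²/L³) atTop (𝓝 0)`); it CONTAINS the bubble-blind class of `BubbleTrivialityOnZ3` (`B(β_c) < ∞ ⟹ χ_L(β_c)²/L³ → 0`,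 `LongRangeIsing.tendsto_boxSusceptibility_sq_div_of_summable_sq`, the `ℓ`-split of "the bubble condition implies triviality") and through it the interaction-uniform class `InteractionUniformZ3` of `LongRangeTrivialityOnZ3` [cite: Panis2023Triviality, Remark 1.6 (p. 7) and Theorem 12.2 (p. 51)]; the containment is strict at the level of two-point functions: `⟨σ₀σ_x⟩ ≍ |x|^{-3/2}(log|x|)^{-1/4}` has `B_n ≍ √(log n) → ∞` and `χ_L ≍ L^{3/2}(log L)^{-1/4} = o(L^{3/2})`
- blocks: `HasNonGaussianSmearingZ3 J` for every such `J`; for every member of `Z3Model` with MMS-monotone critical two-point function (the nearest-neighbour model included, granted MMS2 for it in this formalisation) a non-Gaussian critical smearing forces `limsup_L χ_L(β_c)/L^{3/2} > 0`, i.e. `χ_L(β_c)² ≥ cL³` for some `c > 0` and infinitely many `L` (`hasNonGaussianSmearingZ3_member_imp_frequently`) — strictly more than the divergence of the bubble `B(β_c) = ∞` recorded by generation 2 (`hasNonGaussianSmearingZ3_member_imp`), which it implies [cite: Panis2023Triviality, Theorem 12.2 (p. 51)]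
- because: the tree-graph Wick bound controls the deviation of `T_{f,L,β}` from Gaussianity by `𝒮_T = Σ_L⁻²∑_{v∈ℤ³}F_{RL}(v)⁴`, `F_N(v) = ∑_{y∈Λ_N}⟨σ_vσ_y⟩` [cite: Panis2023Triviality, proof of Theorem 5.5 (pp. 21–22) with Proposition 4.6]; MMS2 gives `F_{RL} ≤ 730·125R³χ_L` everywhere [cite: Panis2023Triviality, Corollary 3.3 (MMS2)] and, averaged over `Λ_{⌊|w|/3⌋}`, the pointwise decay `⟨σ₀σ_w⟩²|w|_∞³ ≤ ε` from `χ_k² ≤ εk³`; so `F⁴` is dominated by `a⁴ = (730·125R³χ_L)⁴` up to the crossover radius `M₁ ≍ (|Λ_{RL}|⁴ε²/a⁴)^{1/6}` and by `9|Λ_{RL}|⁴ε²|v|_∞^{-6}` beyond, a majorant of total mass `≲ (RL)³a⁴ + a²|Λ_{RL}|²ε`, and `Σ_L ≥ (L+1)³χ_L` leaves `𝒮_T ≲ R¹⁵(χ_L²/L³ + ε) → 0` (`LongRangeIsing.treeFourBoxSum_le_of_boxSusceptibility`); conversely Jensen's inequality gives `𝒮_T ≥ Σ_L²/|Λ_{RL}|³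 ≥ χ_L²/(3⁹R⁹L³)`, so nothing weaker than `χ_L = o(L^{3/2})` can feed the mechanism — the dimension count `|U₄|/S₄ ≤ CL^d/L^{2(d-2+η)} = C/L^{d-4+2η}` with `d = 3` vanishes exactly when `η > 1/2` [cite: AizenmanCDM2020, §10.1 eqs. (10.1)–(10.2), p. 31]
- evasions_known: the nearest-neighbour model on `ℤ³` LEAVES even this class, by a theorem — not by the divergence of the bubble (`B(β_c) = ∞`, `B_n(β_c) ≥ c√(log n)` [cite: DuminilCopinPanis2025LowerBounds, Theorem 1.8 and Remark 1.9], which is compatible with `χ_L = o(L^{3/2})`, see technique_class) but by the new lower bound "Theorem 1.3. Let `d ≥ 3`. There exist `c₁, N₁ > 0` such that for all `β ≤ β_c` and for all `N₁ ≤ n ≤ L(β)`, `⟨τ₀τ_{ne₁}⟩_β ≥ c₁/(χ_{4n}(β) + n^{d-2}∑_{1≤k≤2n}k⟨τ₀τ_{ke₁}⟩_β)`" [cite: DuminilCopinPanis2025LowerBounds, Theorem 1.3], applied at `β_c` (`L(β_c) = ∞`, as in the printed proof of Theorem 1.8): if `χ_n(β_c) ≤ εn^{3/2}` for all `n ≥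 n₀` then, by the MMS inequalities (`∑_{k≤m}k²⟨τ₀τ_{ke₁}⟩ ≤ χ_m/2` and dyadic summation), `∑_{k≤2n}k⟨τ₀τ_{ke₁}⟩ ≤ A_{n₀} + Cε√n`, whence `⟨τ₀τ_{ne₁}⟩_{β_c} ≥ c/(εn^{3/2})` for large `n`, then `⟨τ₀τ_x⟩_{β_c} ≥ c/(ε|x|₁^{3/2})` by MMS and `χ_n(β_c) ≥ (c′/ε)n^{3/2} > εn^{3/2}` once `ε² < c′` — a contradiction; so `limsup_n χ_n(β_c)/n^{3/2} ≥ √c′ > 0` UNCONDITIONALLY for the nearest-neighbour model on `ℤ³` (the printed corollary is the conditional "Theorem 1.5. Let `d = 3`. If the critical exponent `η` exists, it satisfies `η ≤ 1/2`" [cite: DuminilCopinPanis2025LowerBounds, Theorem 1.5]); this is exactly the necessary condition of `hasNonGaussianSmearingZ3_member_imp_frequently`, so the reflected-current lower bound of Duminil-Copin–Panis is the input a nearest-neighbour proof must (and can) consume; it is NOT sufficient (`ℤ⁴`: `⟨τ₀τ_x⟩ ≥ c/(|x|²log|x|)` gives `χ_L ≫ L^{3/2}` and the limit is Gaussian [cite: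 DuminilCopinPanis2025LowerBounds, Theorem 1.4] [cite: AizenmanDuminilCopinAnnals2021, Theorem 1.2]; on `ℤ³` the marginal member `α = 3/2`, `⟨σ₀σ_x⟩ ≍ |x|^{-3/2}` up to constants below `L(β)` [cite: Panis2023Triviality, Theorem 1.9 and Corollary 1.11]); what is missing is a LOWER bound on `|U₄|` of the order of the tree diagram (a uniformly positive intersection probability of two critical current clusters with distant sources, open question 1 of §11) [cite: AizenmanCDM2020, Lemma 8.1 eq. (8.1) (p. 25) and §11 (p. 35)]
- scope_caveats: (a) smeared averages `T_{f,L,β_c}` with the `Σ_L(β_c)` normalisation and the free-boundary box-limit state, exactly as in `LongRangeTrivialityOnZ3` (a) and `BubbleTrivialityOnZ3` (a); the pointwise clause (iii) is covered under the bubble condition by generation 3 (`LongRangeTrivialityOnZ3PointwiseAudit.lean`) and is NOT re-proved here under the weaker hypothesis `χ_L = o(L^{3/2})`; (b) MMS2 at `β_c` is a hypothesis for general `J` — proved for `C₀|x-y|₁^{-d-α}` (`panis_mms_two_point_monotone_holds`), carried as a hypothesis for the nearest-neighbour member (`…of_member`), as in generation 2 (b); (c) "exact reach" refers to the tree-diagram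 route as formalised — Gaussianity read off `𝒮_T(β_c,L,R) → 0` through `mgfDeviation_le_tree`; improved tree diagram bounds (the `d_eff = 4` mechanism of Theorem 1.9, the `ℤ⁴` argument of Aizenman–Duminil-Copin) are a different mechanism, not blocked and not covered [cite: Panis2023Triviality, Theorem 1.9 and Corollary 1.11]; (d) `β_c` is the tree's `sInf {β > 0 | m*(β) > 0}` (`0` without a transition; then the state is a product measure and the conclusion holds by independence); (e) the nearest-neighbour half of evasions_known is a paper derivation from the quoted Theorem 1.3 and the MMS inequalities, recorded here and not formalised (the tree's nearest-neighbour Gibbs state `NNIsing.…` and `LongRangeIsing.state (nnCoupling 3)` are not bridged); (f) nothing is said about interactions violating MMS2 or translation invariance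
- status: established (PROVED: `SusceptibilityTrivialityOnZ3_holds`; axioms `propext`, `Classical.choice`, `Quot.sound`)

[cite: Panis2023Triviality, Remark 1.6 (p. 7), proof of Theorem 5.5 (pp. 21–22) and Theorem 12.2 (p. 51)] -/
def SusceptibilityTrivialityOnZ3 : Prop :=
  ∀ J : Site 3 → Site 3 → ℝ, (∀ x y, 0 ≤ J x y) → (∀ a x y, J (x + a) (y + a) = J x y) →
    (0 < LongRangeIsing.criticalBeta J → ∀ x y : Site 3, (3 : ℝ) * ‖x‖ ≤ ‖y‖ →
      pairCorrelation J (LongRangeIsing.criticalBeta J) 0 y ≤ pairCorrelation J (LongRangeIsing.criticalBeta J) 0 x) →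
    Tendsto (fun L : ℕ => boxSusceptibility J (LongRangeIsing.criticalBeta J) L ^ 2 / (L : ℝ) ^ 3)
      atTop (𝓝 0) →
      ¬ HasNonGaussianSmearingZ3 J

/-- **The sharpened barrier holds.** [cite: Panis2023Triviality, Remark 1.6 (p. 7) and Theorem 12.2 (p. 51)] -/
theorem SusceptibilityTrivialityOnZ3_holds : SusceptibilityTrivialityOnZ3 :=
  fun _ hJ hJt hmms hχ => not_hasNonGaussianSmearingZ3_of_boxSusceptibility hJ hJt hmms hχ

/-- **Generation 4 implies generation 2**: the bubble condition gives `χ_L(β_c)²/L³ → 0`.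
[cite: Panis2023Triviality, Theorem 12.2 (p. 51)] -/
theorem SusceptibilityTrivialityOnZ3.bubbleTrivialityOnZ3 (h : SusceptibilityTrivialityOnZ3) :
    BubbleTrivialityOnZ3 := fun J hJ hJt hmms hB =>
  h J hJ hJt hmms (tendsto_boxSusceptibility_sq_div_of_summable_sq J _ (criticalBeta_nonneg J) hJ hJt hB)

/-- **Generation 4 implies the catalogued barrier** (`α < 3/2 ⟹ B(β_c) < ∞ ⟹ χ_L = o(L^{3/2}) ⟹`
Gaussian). [cite: Panis2023Triviality, Theorem 1.2 and Theorem 12.2] -/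
theorem SusceptibilityTrivialityOnZ3.longRangeTrivialityOnZ3 (h : SusceptibilityTrivialityOnZ3) :
    LongRangeTrivialityOnZ3 :=
  h.bubbleTrivialityOnZ3.longRangeTrivialityOnZ3

/-- **The sharpened barrier on the family `Z3Model`** (nearest-neighbour member included, MMS2 for it a
hypothesis): a member with MMS-monotone critical two-point function and `χ_L(β_c) = o(L^{3/2})` has
Gaussian critical smearings. [cite: Panis2023Triviality, Remark 1.6 and Theorem 12.2] -/
theorem SusceptibilityTrivialityOnZ3.of_member (h : SusceptibilityTrivialityOnZ3) (m : Z3Model)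
    (hmms : 0 < LongRangeIsing.criticalBeta m.coupling → ∀ x y : Site 3, (3 : ℝ) * ‖x‖ ≤ ‖y‖ →
      pairCorrelation m.coupling (LongRangeIsing.criticalBeta m.coupling) 0 y ≤
        pairCorrelation m.coupling (LongRangeIsing.criticalBeta m.coupling) 0 x)
    (hχ : Tendsto (fun L : ℕ => boxSusceptibility m.coupling (LongRangeIsing.criticalBeta m.coupling) L ^ 2 /
      (L : ℝ) ^ 3) atTop (𝓝 0)) :
    ¬ HasNonGaussianSmearingZ3 m.coupling :=
  h m.coupling m.coupling_nonneg m.coupling_add hmms hχ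

/-- **Non-triviality on `ℤ³` costs `χ_L(β_c) ≠ o(L^{3/2})`**: for any member of `Z3Model` with
MMS-monotone critical two-point function — in particular for the nearest-neighbour model, granted MMS2
for it — a non-Gaussian critical smearing implies that `χ_L(β_c)²/L³` does NOT tend to `0`.
[cite: Panis2023Triviality, Theorem 12.2] -/
theorem hasNonGaussianSmearingZ3_member_imp_not_tendsto (m : Z3Model)
    (hmms : 0 < LongRangeIsing.criticalBeta m.coupling → ∀ x y : Site 3, (3 : ℝ) * ‖x‖ ≤ ‖y‖ →
      pairCorrelation m.coupling (LongRangeIsing.criticalBeta m.coupling) 0 y ≤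
        pairCorrelation m.coupling (LongRangeIsing.criticalBeta m.coupling) 0 x)
    (hng : HasNonGaussianSmearingZ3 m.coupling) :
    ¬ Tendsto (fun L : ℕ => boxSusceptibility m.coupling (LongRangeIsing.criticalBeta m.coupling) L ^ 2 /
      (L : ℝ) ^ 3) atTop (𝓝 0) :=
  fun hχ => SusceptibilityTrivialityOnZ3_holds.of_member m hmms hχ hng

/-- **The quantitative form of the cost**: under the same hypotheses there is `c > 0` with
`χ_L(β_c)² ≥ cL³` for infinitely many `L` — "`η ≤ 1/2`" in lim-sup form, the necessary condition that
Duminil-Copin–Panis's Theorem 1.3 verifies for the nearest-neighbour model on `ℤ³` (see the block of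
`SusceptibilityTrivialityOnZ3`). [cite: DuminilCopinPanis2025LowerBounds, Theorems 1.3 and 1.5] -/
theorem hasNonGaussianSmearingZ3_member_imp_frequently (m : Z3Model)
    (hmms : 0 < LongRangeIsing.criticalBeta m.coupling → ∀ x y : Site 3, (3 : ℝ) * ‖x‖ ≤ ‖y‖ →
      pairCorrelation m.coupling (LongRangeIsing.criticalBeta m.coupling) 0 y ≤
        pairCorrelation m.coupling (LongRangeIsing.criticalBeta m.coupling) 0 x)
    (hng : HasNonGaussianSmearingZ3 m.coupling) :
    ∃ c : ℝ, 0 < c ∧ ∃ᶠ L : ℕ in atTop,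
      c * (L : ℝ) ^ 3 ≤ boxSusceptibility m.coupling (LongRangeIsing.criticalBeta m.coupling) L ^ 2 := by
  have h := hasNonGaussianSmearingZ3_member_imp_not_tendsto m hmms hng
  obtain ⟨c, hc, hfreq⟩ := exists_frequently_le_of_not_tendsto
    (fun L => div_nonneg (sq_nonneg _) (pow_nonneg (Nat.cast_nonneg L) 3)) h
  refine ⟨c, hc, hfreq.mono fun L hL => ?_⟩
  by_cases hL3 : (0 : ℝ) < (L : ℝ) ^ 3
  · exact (le_div_iff₀ hL3).1 hL
  · have h0 : (L : ℝ) ^ 3 = 0 := le_antisymm (not_lt.1 hL3) (pow_nonneg (Nat.cast_nonneg L) 3)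
    rw [h0, mul_zero]
    exact sq_nonneg _

/-- **"`χ_L(β_c) = o(L^{3/2})` ⟹ Gaussian critical smearing" IS an interaction-uniform property on `ℤ³`**
(it holds for every member of `Z3Model`, MMS2 granted): the barrier separates models by the growth of
the critical box susceptibility — not by the range of the interaction, and not by the finiteness of the
bubble diagram. [cite: Panis2023Triviality, Remark 1.6 and Theorem 12.2] -/
theorem interactionUniformZ3_susceptibility_triviality :
    InteractionUniformZ3 fun m =>
      (0 < LongRangeIsing.criticalBeta m.coupling → ∀ x y : Site 3, (3 : ℝ) * ‖x‖ ≤ ‖y‖ →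
        pairCorrelation m.coupling (LongRangeIsing.criticalBeta m.coupling) 0 y ≤
          pairCorrelation m.coupling (LongRangeIsing.criticalBeta m.coupling) 0 x) →
      Tendsto (fun L : ℕ => boxSusceptibility m.coupling (LongRangeIsing.criticalBeta m.coupling) L ^ 2 /
        (L : ℝ) ^ 3) atTop (𝓝 0) →
        ¬ HasNonGaussianSmearingZ3 m.coupling :=
  fun m hmms hχ => SusceptibilityTrivialityOnZ3_holds.of_member m hmms hχ

end Literature.Barriers.CriticalPhenomena

end
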